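import Mathlib.Analysis.Normed.Lp.lpSpace
import Literature.Analysis.Calculus.ParametricContraction
import HarnessLib

/-!
# `RigorousRGSmallParameter` (Slade, Theorem 1.4.1): the flow until the mass scale —
# Theorem 7.2.2 (`T` is a contraction of `B₁(X)`), Lemma 7.2.1 and Corollary 7.2.4 (the
# critical initial value `μ₀` and its continuity), with the renormalisation-group inputs explicit

Companion ("proof architecture") file of
`Literature/Barriers/CriticalPhenomena/RigorousRGSmallParameter.lean`, in the style of
`RigorousRGSmallParameterFlowExponent.lean` (Lemma 8.1.1 with its inputs explicit). Source:
G. Slade, *Critical exponents for long-range `O(n)` models below the upper critical dimension*,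
Commun. Math. Phys. **358** (2018) 343–436, arXiv:1611.06169v4, read from the TeX source
(theorem numbers are those of the published numbering; displays are quoted by their `\label`
order in §7, as (7.k)).

## Where this sits in the printed proof

The tree reduces the barrier to the named fact `LongRangePhi4.Slade2017_prop822`
(Proposition 8.2.2 with Corollaries 7.2.4–7.2.5), the output of the renormalisation-group flow of
§7 fed by the single-step estimates of Theorem 6.3.1 ([BS-rg-step] adapted). §7.2 is the heart
of §7: "we construct a global renormalisation group flow … by tuning the initial value
`ν₀ = ν₀(m²)` to a critical value. The main effort lies in constructing a flow that exists for
scales up to the mass scale `j_m`" (§7, opening), done "via the identification of a fixed point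
for a map `T` on a certain Banach space" (§7.2). Its ingredients are:

* (§7.1, Lemma 7.1.1) the flow equations in the variables `(μ_j, y_j, K_j)`
  (`y_j = s̄ - s_j`, `s̄ = a⁻¹(1 - L^{-ε})` the perturbative fixed point (5.31)):
  `μ_{j+1} = L^α μ_j + ρ_{μ,j} + r_{μ,j}`,
  `y_{j+1} = c_ε y_j + aL^ε y_j² + (β^:_j - a)L^ε(s̄ - y_j)² + r_{y,j}`,
  `K_{j+1} = Ǩ_{j+1}(μ_j, y_j, K_j)`, with `c_ε = 2 - L^ε`,
  `ρ_{μ,j} = -L^α(γ̂β_jμ_j(s̄ - y_j) + ξ̃_j(s̄ - y_j)²)` ((7.11)), and, "Suppose that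
  `(g_j,ν_j,K_j) ∈ 𝔻_j`. Then for `r_* = r_μ, r_s`, and for derivatives `D = D_μ, D_s`,
  `|r_{*,j}| ≤ O(s̄³)`, `|Dr_{*,j}| ≤ O(s̄²)`, `‖D_K r_{*,j}‖ ≤ O(1)`, `‖DǨ_{j+1}‖ ≤ O(s̄²)`"
  ((7.16),
  from Theorem 6.3.1 through Proposition 5.3.1), together with `‖K_+‖ ≤ C_RG s̄³`,
  `‖D_K K_+‖ ≤ κ < 1` ((7.4), (7.6));
* (Lemma 5.2.1, (7.19)) `|β_j| = O(1)`, `Π = sup_{m²,j}|ξ̃_j| < ∞`; (Lemma 5.2.4) "There exist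
  `J_L` and `b_L` such that … `|β^:_j(m²) - a| ≤ b_L` (`j ≤ J_L`), `≤ a/64`
  (`J_L ≤ j ≤ j_m - J_L`)";
* (§7.2.1) the Banach space `X = ⊕_{j≥0} X_j`, `X_0 = ℝ ∋ μ_0`,
  `X_j = ℝ × ℝ × 𝒲*_j ∋ (μ_j, y_j, K_j)`,
  with the weighted supremum norm (7.17)–(7.18): weights `𝔴_μ = σs̄²`, `𝔴_{y,j} = ω_js̄`,
  `𝔴_K = λ_Ks̄³`, `σ = 5Π`, `λ_K = C_RG`, `ω = 1/32`, `ζ = 1 - 64b_Ls̄`,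
  `ω_j = ωζ^{(J_L-j)₊}` ((7.19)–(7.20)); the initial condition `(y_0, K_0 = 𝟙_∅)`,
  `|y_0| ≤ ω_0s̄`, is not part of `X`; and (7.9): `x ∈ B₁(X) ⇒ (g_j,ν_j,K_j) ∈ 𝔻_j`;
* (§7.2.2) the map `T̂` ((7.22)–(7.24): `(T̂⁽μ⁾x)_j = L^{-α}(μ_{j+1} - ρ_{μ,j} - r_{μ,j})`,
  `(T̂⁽ʸ⁾x)_j = c_εy_{j-1} + aL^εy_{j-1}² + (β^:_{j-1} - a)L^ε(s̄ - y_{j-1})² + r_{y,j-1}`,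
  `(T̂⁽ᴷ⁾x)_j = Ǩ_j(μ_{j-1}, y_{j-1}, K_{j-1})` for `j ≤ j_m̃`, zero beyond), its smoothing `T`
  (the rows at `j_m̃ + 1` multiplied by `1 - δ_m̃`, `δ_m̃ = ⌈f_m̃⌉ - f_m̃`, (7.25)–(7.27)),
  Lemma 7.2.1 (continuity of `Tx` in `(m̃², m²) ∈ 𝕄`), Theorem 7.2.2 ("`T : B₁ → B₁`, and there
  exists `c ∈ (0,1)` … such that `‖DT‖ ≤ c` on `B₁`"), and §7.2.4: the fixed point `x^c` by
  the contraction mapping principle, `μ₀ = (x^c_0)^{(μ)}`, Corollary 7.2.4 ("`μ₀(m̃², m²)` is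
  continuous in `(m̃², m²) ∈ 𝕄`", by "the version of the contraction mapping principle given in
  [LS14]" — in the tree: `Literature.Analysis.Calculus.ParametricContraction`).

## What this file does (everything is proved; no named fact is introduced)

The renormalisation-group objects are taken ABSTRACTLY: arbitrary real Banach spaces `𝒲_j`
(`W j`) for the coordinates `K_j`, arbitrary functions `r_{μ,j}, r_{y,j} : ℝ × ℝ × 𝒲_j → ℝ`,
`Ǩ_{j+1} : ℝ × ℝ × 𝒲_j → 𝒲_{j+1}` and coefficient sequences `β_j, β^:_j, ξ̃_j`
(`CriticalFlow.Data`), scale-independent constants (`CriticalFlow.Consts`), and the bounds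
listed above as the hypothesis `CriticalFlow.Hyp` — the derivative bounds (7.16), (7.6) in
LIPSCHITZ form on the domain (7.9) (which is what the printed `‖DT‖ ≤ c` is used for, through
the mean-value inequality on the convex ball `B₁`), the constants' smallness conditions written
out ("we fix `L` large enough and then choose `ε` small enough depending on `L`": `L^{-α} ≤ ¼`,
`x = L^ε - 1 ≤ 1/10`, `64(J_L+1)b_Ls̄ ≤ 1/10`, and `s₁`–`s₇` of the form `(L-dependent
constant)·s̄ ≤ (L-dependent constant)`), and the relation `as̄L^ε = L^ε - 1` ((5.31)). Then:

* `FlowSpace.*` — the space `X` as Mathlib's `lp (j ↦ ℝ × ℝ × 𝒲_j) ∞` in the RESCALED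
  coordinates `(μ_j/𝔴_μ, y_j/𝔴_{y,j}, K_j/𝔴_K)` (so that `B₁(X)` is the closed unit ball; the
  product norm of Mathlib is the maximum norm), the operator induced by a row map
  (`liftOp`), and the contraction-mapping construction on `B₁` with and without a parameter
  (`exists_fixedPoint`, `exists_fixedPoint'`, from `ParametricContraction`), including the
  criterion for continuity in the parameter from coordinatewise continuity plus local
  finiteness of the non-zero rows (`liftOp_continuousOn`) — the mechanism of Lemma 7.2.1.
* `CriticalFlow.Trow` — the map `T` ((7.22)–(7.27)) in rescaled coordinates, each row
  multiplied by a truncation weight `w_j ∈ [0,1]` (`1` for `j ≤ j_m̃`, `1 - δ_m̃` at `j_m̃ + 1`,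
  `0` beyond; all `1` in the massless case `m̃² = m² = 0`); `CriticalFlow.truncWeight` — the
  weights in closed form `w_j = min(1, max(0, f_m̃ + 2 - j))` with `truncWeight_eq_one`
  (`j ≤ ⌈f⌉`), `truncWeight_ceil_succ` (`= 1 - δ`), `truncWeight_eq_zero` (`j ≥ ⌈f⌉ + 2`),
  continuity in `f` and local finiteness (`truncWeight_hyp`).
* **Theorem 7.2.2, `T : B₁ → B₁`** — `Hyp.norm_trow_le`, through (7.27) `Hyp.abs_rowμ_le`
  (`L^{-α}σs̄² + Π(33/32)²s̄² + O(s̄³) ≤ σs̄²`), (7.29)–(7.31) `Hyp.abs_rowy_succ_le` (the two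
  cases `j < J_L`: the factor `ζ = ω_{j-1}/ω_j` beats the lattice-transient term `b_L`, and
  `J_L ≤ j`: `|β^:_j - a| ≤ a/64` and `as̄L^ε = x`), (7.28) `Hyp.norm_rowK_le`.
* **Theorem 7.2.2, contraction** — `Hyp.dist_trow_le`: on `B₁`, `T` is Lipschitz with ratio
  `cLip = 1 - x/4 < 1` (`x = L^ε - 1 ∼ ε log L`; printed: `1 - ¾ε log L` from (7.44)), through
  the rows (7.32)–(7.34) `Hyp.abs_rowμ_sub_le` (`≤ ½`), (7.35)–(7.36) `Hyp.norm_rowK_sub_le`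
  (`≤ ¾`, using `κ ≤ ¼`), (7.37)–(7.44) `Hyp.abs_rowy_succ_sub_le` (`≤ 1 - x/4`).
  `Slade2017_thm722` packages both halves on `X`; `exists_fixedPoint` is the fixed point
  `x^c ∈ B₁` (unique) of §7.2.4; `flow_of_fixedPoint` extracts the flow: the coordinates stay in
  the domain (7.9) at all scales and solve the flow equations of Lemma 7.1.1 at the scales of
  weight one (and `μ_j = 0` where the weight vanishes — the final condition).
* **Lemma 7.2.1** — `Slade2017_lem721`: `p ↦ T_p x` is continuous into `X` for `x ∈ B₁` when
  the data depend continuously on `p` pointwise and the weights are continuous and locally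
  finitely supported.
* **Corollary 7.2.4** — `Slade2017_cor724`: the fixed point `x^c(p)`, hence
  `μ₀(p) = 𝔴_μ · (x^c(p))_0^{(μ)}`, is continuous on the parameter set.

## Reading of the constants, and two remarks on the printed text

1. (7.34) bounds `‖D_yT⁽ᴷ⁾‖` by `ω_{j-1}s̄ · C_RG s̄²/(λ_Ks̄³) = ω` — i.e. it takes the constant
   of `‖D_V K_+‖ ≤ C_{(1,0)}ϑ³s̄²` ((7.6)) equal to `C_RG`; here that constant is a separate
   input `CK` with the hypothesis `CK ≤ 8λ_K`. The domain on which the bounds are asked is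
   `|μ| ≤ σs̄²`, `|y| ≤ s̄/32`, `‖K‖ ≤ λ_Ks̄³` (what `x ∈ B₁` gives, (7.9)).
2. §7.2.4 defines `μ₀(m²) = μ₀(m²_-(m²), m²)` with `m²_-` "the least value of `u²` for which
   `j_u = j_m - (J_L+2)`". Since `j_m = ⌈f_m⌉` ((3.8)) is integer valued, `m²_-(·)` is a step
   function of `m²`, and the "in particular, `μ₀(m²)` is continuous in `m² ∈ (0,δ]`" of
   Corollary 7.2.4 needs `m̃²` to be chosen continuously in `m²` instead (e.g.
   `m̃² = L^{α(J_L+3)}m²`, for which `j_m̃ = j_m - J_L - 3` and `(m̃², m²) ∈ 𝕄`; Lemma 7.2.7 then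
   advances `J_L + 3` scales) — this is exactly what the `(1 - δ_m̃)` smoothing and the JOINT
   continuity on `𝕄` are for. The abstract `Slade2017_cor724` is stated for an arbitrary
   parameter set and is unaffected; the remark concerns its application.

Not treated here: Corollary 7.2.5 (right-continuity of `μ₀` at `m² = 0`), Lemma 7.2.7,
Theorem 7.3.1 (flow beyond the mass scale), the derivation of Lemma 7.1.1 from Theorem 6.3.1
and Proposition 5.3.1, and Theorem 6.3.1 itself (the renormalisation-group step, [BS-rg-step]).

## References

* G. Slade, Commun. Math. Phys. 358 (2018) 343–436, arXiv:1611.06169v4: §5.2 (Lemmas 5.2.1,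
  5.2.4), §5.4 ((5.31)), §6.3 (Theorem 6.3.1), §7.1 (Lemma 7.1.1), §7.2 ((7.17)–(7.44),
  Lemma 7.2.1, Theorem 7.2.2, Corollary 7.2.4). [Slade2017]
* L.H. Loomis, S. Sternberg, *Advanced Calculus* (2014 ed.), the [LS14] of the source; in the
  tree `Literature.Analysis.Calculus.ParametricContraction` (Copson, *Metric Spaces*, §80).
-/

noncomputable section

namespace Literature.Barriers.CriticalPhenomena

open Set Metric Filter Function
open scoped Topology NNReal ENNReal

namespace LongRangePhi4

namespace FlowSpace

variable {E : ℕ → Type*} [∀ j, NormedAddCommGroup (E j)]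

/-- A uniformly bounded sequence is in `ℓ^∞`. [folklore] -/
theorem memℓp_infty_of_forall_le {f : ∀ j, E j} {C : ℝ} (h : ∀ j, ‖f j‖ ≤ C) : Memℓp f ∞ :=
  memℓp_infty ⟨C, by rintro _ ⟨j, rfl⟩; exact h j⟩

/-- A coordinate is bounded by the supremum norm. [folklore] -/
theorem norm_apply_le (x : lp E ∞) (j : ℕ) : ‖x j‖ ≤ ‖x‖ :=
  lp.norm_apply_le_norm ENNReal.top_ne_zero x j

/-- The supremum norm is bounded by a uniform bound on the coordinates. [folklore] -/
theorem norm_le {x : lp E ∞} {C : ℝ} (hC : 0 ≤ C) (h : ∀ j, ‖x j‖ ≤ C) : ‖x‖ ≤ C :=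
  lp.norm_le_of_forall_le hC h

/-- Coordinate distances are bounded by the `ℓ^∞` distance. [folklore] -/
theorem dist_apply_le (x x' : lp E ∞) (j : ℕ) : dist (x j) (x' j) ≤ dist x x' := by
  rw [dist_eq_norm, dist_eq_norm]
  have : x j - x' j = (x - x') j := by rw [lp.coeFn_sub, Pi.sub_apply]
  rw [this]; exact norm_apply_le _ j

/-- The `ℓ^∞` distance is bounded by a uniform bound on the coordinate distances. [folklore] -/
theorem dist_le {x x' : lp E ∞} {C : ℝ} (hC : 0 ≤ C) (h : ∀ j, dist (x j) (x' j) ≤ C) :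
    dist x x' ≤ C := by
  rw [dist_eq_norm]
  refine norm_le hC fun j => ?_
  rw [lp.coeFn_sub, Pi.sub_apply, ← dist_eq_norm]; exact h j

/-- `x ∈ B_r(0)` iff every coordinate has norm `≤ r` (the unit ball `B₁(X)` of (7.17)).
[folklore] -/
theorem mem_closedBall_zero_iff {x : lp E ∞} {r : ℝ} (hr : 0 ≤ r) :
    x ∈ closedBall (0 : lp E ∞) r ↔ ∀ j, ‖x j‖ ≤ r := by
  rw [mem_closedBall, dist_zero_right]
  exact ⟨fun h j => (norm_apply_le x j).trans h, norm_le hr⟩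

/-- The operator on `X = ℓ^∞(E)` induced by a raw map of sequences `Φ` (zero where `Φ x` is
unbounded; on the unit ball, where it is used, `Φ x` is bounded). [folklore] -/
def liftOp (Φ : (∀ j, E j) → (∀ j, E j)) (x : lp E ∞) : lp E ∞ := by
  classical exact if h : Memℓp (Φ x) ∞ then ⟨Φ x, h⟩ else 0

/-- On inputs where the row map is bounded, `liftOp Φ x` is the sequence `Φ x`. [folklore] -/
theorem coeFn_liftOp {Φ : (∀ j, E j) → (∀ j, E j)} {x : lp E ∞} {C : ℝ}
    (h : ∀ j, ‖Φ x j‖ ≤ C) : ⇑(liftOp Φ x) = Φ x := by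
  classical
  have hm : Memℓp (Φ x) ∞ := memℓp_infty_of_forall_le h
  simp only [liftOp, dif_pos hm]

/-- If the rows map the unit ball to coordinates of norm `≤ 1`, the operator maps `B₁` to `B₁`.
[folklore] -/
theorem liftOp_mapsTo {Φ : (∀ j, E j) → (∀ j, E j)}
    (h : ∀ x : lp E ∞, (∀ j, ‖x j‖ ≤ 1) → ∀ j, ‖Φ x j‖ ≤ 1) :
    MapsTo (liftOp Φ) (closedBall 0 1) (closedBall 0 1) := by
  intro x hx
  rw [mem_closedBall_zero_iff zero_le_one] at hx ⊢
  intro j; rw [coeFn_liftOp (h x hx)]; exact h x hx j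

/-- A uniform coordinatewise Lipschitz bound on `B₁` gives a Lipschitz bound in `ℓ^∞`. [folklore] -/
theorem liftOp_lipschitzOnWith {Φ : (∀ j, E j) → (∀ j, E j)} {c : ℝ≥0}
    (hb : ∀ x : lp E ∞, (∀ j, ‖x j‖ ≤ 1) → ∀ j, ‖Φ x j‖ ≤ 1)
    (h : ∀ x x' : lp E ∞, (∀ j, ‖x j‖ ≤ 1) → (∀ j, ‖x' j‖ ≤ 1) →
      ∀ j, dist (Φ x j) (Φ x' j) ≤ c * dist x x') :
    LipschitzOnWith c (liftOp Φ) (closedBall 0 1) := by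
  refine LipschitzOnWith.of_dist_le_mul fun x hx x' hx' => ?_
  rw [mem_closedBall_zero_iff zero_le_one] at hx hx'
  refine dist_le (by positivity) fun j => ?_
  rw [coeFn_liftOp (hb x hx), coeFn_liftOp (hb x' hx')]
  exact h x x' hx hx' j

/-- Continuity in a parameter at a point, from coordinatewise continuity and local finiteness of the
non-zero rows (the mechanism of Slade's Lemma 7.2.1: "It suffices to prove the continuity of
`(Tx)_j` for each `j`"). [cite: Slade2017, Lemma 7.2.1 (proof)] -/
theorem liftOp_continuousWithinAt {P : Type*} [TopologicalSpace P]
    {Φ : P → (∀ j, E j) → (∀ j, E j)} {S : Set P} {p₀ : P} {x : lp E ∞} {C : ℝ}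
    (hb : ∀ p ∈ S, ∀ j, ‖Φ p x j‖ ≤ C) (hp₀ : p₀ ∈ S)
    (hcoord : ∀ j, ContinuousWithinAt (fun p => Φ p x j) S p₀)
    (hsupp : ∃ U ∈ 𝓝[S] p₀, ∃ J : ℕ, ∀ p ∈ U, ∀ j, J ≤ j → Φ p x j = 0) :
    ContinuousWithinAt (fun p => liftOp (Φ p) x) S p₀ := by
  rw [ContinuousWithinAt, Metric.tendsto_nhds]
  intro ε hε
  obtain ⟨U, hU, J, hJ⟩ := hsupp
  have hp₀U : p₀ ∈ U := mem_of_mem_nhdsWithin hp₀ hU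
  have hfin : ∀ᶠ p in 𝓝[S] p₀, ∀ j ∈ Finset.range J,
      dist (Φ p x j) (Φ p₀ x j) < ε / 2 := by
    rw [Filter.eventually_all_finset]
    intro j _
    exact Metric.tendsto_nhds.1 (hcoord j) (ε / 2) (half_pos hε)
  filter_upwards [hU, hfin, self_mem_nhdsWithin] with p hpU hpfin hpS
  have hle : dist (liftOp (Φ p) x) (liftOp (Φ p₀) x) ≤ ε / 2 := by
    refine dist_le (half_pos hε).le fun j => ?_
    rw [coeFn_liftOp (hb p hpS), coeFn_liftOp (hb p₀ hp₀)]
    by_cases hj : j < J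
    · exact (hpfin j (Finset.mem_range.2 hj)).le
    · rw [hJ p hpU j (not_lt.1 hj), hJ p₀ hp₀U j (not_lt.1 hj), dist_self]
      exact (half_pos hε).le
  exact hle.trans_lt (half_lt_self hε)

/-- Continuity in a parameter on a set, from coordinatewise continuity and local finiteness of the
non-zero rows. [cite: Slade2017, Lemma 7.2.1 (proof)] -/
theorem liftOp_continuousOn {P : Type*} [TopologicalSpace P]
    {Φ : P → (∀ j, E j) → (∀ j, E j)} {S : Set P} {x : lp E ∞} {C : ℝ}
    (hb : ∀ p ∈ S, ∀ j, ‖Φ p x j‖ ≤ C)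
    (hcoord : ∀ j, ContinuousOn (fun p => Φ p x j) S)
    (hsupp : ∀ p₀ ∈ S, ∃ U ∈ 𝓝[S] p₀, ∃ J : ℕ, ∀ p ∈ U, ∀ j, J ≤ j → Φ p x j = 0) :
    ContinuousOn (fun p => liftOp (Φ p) x) S := fun p₀ hp₀ =>
  liftOp_continuousWithinAt hb hp₀ (fun j => hcoord j p₀ hp₀) (hsupp p₀ hp₀)

/-- **The contraction-mapping construction on the unit ball of `X = ℓ^∞(E)`, with a parameter.**
[cite: Copson1968, §80] -/
theorem exists_fixedPoint {P : Type*} [TopologicalSpace P] [∀ j, CompleteSpace (E j)]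
    {Φ : P → (∀ j, E j) → (∀ j, E j)} {S : Set P} {c : ℝ≥0} (hc : c < 1)
    (hb : ∀ p ∈ S, ∀ x : lp E ∞, (∀ j, ‖x j‖ ≤ 1) → ∀ j, ‖Φ p x j‖ ≤ 1)
    (hl : ∀ p ∈ S, ∀ x x' : lp E ∞, (∀ j, ‖x j‖ ≤ 1) → (∀ j, ‖x' j‖ ≤ 1) →
      ∀ j, dist (Φ p x j) (Φ p x' j) ≤ c * dist x x')
    (hcoord : ∀ x : lp E ∞, (∀ j, ‖x j‖ ≤ 1) → ∀ j, ContinuousOn (fun p => Φ p x j) S)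
    (hsupp : ∀ x : lp E ∞, (∀ j, ‖x j‖ ≤ 1) → ∀ p₀ ∈ S,
      ∃ U ∈ 𝓝[S] p₀, ∃ J : ℕ, ∀ p ∈ U, ∀ j, J ≤ j → Φ p x j = 0) :
    ∃ xs : P → lp E ∞, ContinuousOn xs S ∧
      (∀ p ∈ S, (∀ j, ‖xs p j‖ ≤ 1) ∧ ⇑(xs p) = Φ p (xs p)) ∧
      ∀ p ∈ S, ∀ y : lp E ∞, (∀ j, ‖y j‖ ≤ 1) → ⇑y = Φ p y → y = xs p := by
  have hB : IsClosed (closedBall (0 : lp E ∞) 1) := isClosed_closedBall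
  have hBne : (closedBall (0 : lp E ∞) 1).Nonempty := ⟨0, mem_closedBall_self zero_le_one⟩
  obtain ⟨xs, hcont, hfix, huniq⟩ :=
    Literature.Analysis.Calculus.exists_fixedPoint_continuousOn_of_isClosed hB hBne hc
      (T := fun p => liftOp (Φ p))
      (fun p hp => liftOp_mapsTo (hb p hp))
      (fun p hp => liftOp_lipschitzOnWith (hb p hp) (hl p hp))
      (fun x hx => liftOp_continuousOn (C := 1)
        (fun p hp => hb p hp x ((mem_closedBall_zero_iff zero_le_one).1 hx))
        (hcoord x ((mem_closedBall_zero_iff zero_le_one).1 hx))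
        (hsupp x ((mem_closedBall_zero_iff zero_le_one).1 hx)))
  refine ⟨xs, hcont, fun p hp => ?_, fun p hp y hy hfy => ?_⟩
  · have hx1 : ∀ j, ‖xs p j‖ ≤ 1 := (mem_closedBall_zero_iff zero_le_one).1 (hfix p hp).1
    refine ⟨hx1, ?_⟩
    have h := (hfix p hp).2
    funext j
    have hj : (liftOp (Φ p) (xs p)) j = xs p j := by rw [h]
    rw [coeFn_liftOp (hb p hp _ hx1)] at hj
    exact hj.symm
  · refine huniq p hp y ((mem_closedBall_zero_iff zero_le_one).2 hy) ?_
    apply lp.ext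
    rw [coeFn_liftOp (hb p hp _ hy)]; exact hfy.symm

/-- **The contraction-mapping construction on the unit ball of `X = ℓ^∞(E)`** (no parameter).
[cite: Copson1968, §80] -/
theorem exists_fixedPoint' [∀ j, CompleteSpace (E j)]
    {Φ : (∀ j, E j) → (∀ j, E j)} {c : ℝ≥0} (hc : c < 1)
    (hb : ∀ x : lp E ∞, (∀ j, ‖x j‖ ≤ 1) → ∀ j, ‖Φ x j‖ ≤ 1)
    (hl : ∀ x x' : lp E ∞, (∀ j, ‖x j‖ ≤ 1) → (∀ j, ‖x' j‖ ≤ 1) →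
      ∀ j, dist (Φ x j) (Φ x' j) ≤ c * dist x x') :
    ∃ xs : lp E ∞, (∀ j, ‖xs j‖ ≤ 1) ∧ ⇑xs = Φ xs ∧
      ∀ y : lp E ∞, (∀ j, ‖y j‖ ≤ 1) → ⇑y = Φ y → y = xs := by
  have hB : IsClosed (closedBall (0 : lp E ∞) 1) := isClosed_closedBall
  have hBne : (closedBall (0 : lp E ∞) 1).Nonempty := ⟨0, mem_closedBall_self zero_le_one⟩
  obtain ⟨xs, -, hfix, huniq⟩ :=
    Literature.Analysis.Calculus.exists_fixedPoint_continuousOn_of_isClosed hB hBne hc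
      (P := Unit) (S := univ) (T := fun _ => liftOp Φ)
      (fun _ _ => liftOp_mapsTo hb) (fun _ _ => liftOp_lipschitzOnWith hb hl)
      (fun _ _ => continuousOn_const)
  refine ⟨xs (), ?_, ?_, fun y hy hfy => ?_⟩
  · exact (mem_closedBall_zero_iff zero_le_one).1 (hfix () (mem_univ _)).1
  · have hx1 : ∀ j, ‖xs () j‖ ≤ 1 :=
      (mem_closedBall_zero_iff zero_le_one).1 (hfix () (mem_univ _)).1
    have h := (hfix () (mem_univ _)).2
    funext j
    have hj : (liftOp Φ (xs ())) j = xs () j := by rw [h]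
    rw [coeFn_liftOp (hb _ hx1)] at hj
    exact hj.symm
  · refine huniq () (mem_univ _) y ((mem_closedBall_zero_iff zero_le_one).2 hy) ?_
    apply lp.ext
    rw [coeFn_liftOp (hb _ hy)]; exact hfy.symm

/-- Evaluation at a coordinate is continuous on `X = ℓ^∞(E)` (it is `1`-Lipschitz). [folklore] -/
theorem continuous_apply (j : ℕ) : Continuous fun x : lp E ∞ => x j :=
  LipschitzWith.continuous (K := 1) (LipschitzWith.of_dist_le_mul fun x x' => by
    simpa using dist_apply_le x x' j)

end FlowSpace

end LongRangePhi4

end Literature.Barriers.CriticalPhenomena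

namespace Literature.Barriers.CriticalPhenomena

open Set Metric Filter Function
open scoped Topology NNReal ENNReal

namespace LongRangePhi4

namespace CriticalFlow

/-! ### The data of Slade's map `T` (§7.2.2), abstractly -/

/-- Scale-independent constants: `Lα = L^α`, `Lε = L^ε`, `a` (Lemma 5.2.2), `sbar = s̄`
(5.31), `γh = γ̂`, `Pxi = Π` ((7.19)), `Bβ ≥ |β_j|` (Lemma 5.2.1), `bL, JL` (Lemma 5.2.4),
`lamK = λ_K = C_RG` ((7.18)), `κ` ((7.6)), and the constants `C₀, C₂, C₃, CK` of the bounds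
(7.16) on the remainders `r_μ, r_y` and on `Ǩ`.
[cite: Slade2017, §7.2.1 ((7.18)–(7.20)), Lemma 7.1.1 ((7.16))] -/
structure Consts where
  Lα : ℝ
  Lε : ℝ
  a : ℝ
  sbar : ℝ
  γh : ℝ
  Pxi : ℝ
  Bβ : ℝ
  bL : ℝ
  JL : ℕ
  lamK : ℝ
  κ : ℝ
  C₀ : ℝ
  C₂ : ℝ
  C₃ : ℝ
  CK : ℝ

namespace Consts

variable (c : Consts)

/-- `σ = 5Π` ((7.19)). [cite: Slade2017, (7.19)] -/
def σ : ℝ := 5 * c.Pxi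
/-- `ζ = 1 - 64 b_L s̄` (before (7.20)). [cite: Slade2017, §7.2.1 (before (7.20))] -/
def ζ : ℝ := 1 - 64 * c.bL * c.sbar
/-- `ω_j = ω ζ^{(J_L-j)_+}`, `ω = 1/32` ((7.20)). [cite: Slade2017, (7.20)] -/
def omg (j : ℕ) : ℝ := 1 / 32 * c.ζ ^ (c.JL - j)
/-- `x = L^ε - 1` (§5.4: `c_ε = 1 - x`, `x ∼ ε log L`). [cite: Slade2017, §5.4] -/
def xε : ℝ := c.Lε - 1
/-- `c_ε = 2 - L^ε` ((7.10)). [cite: Slade2017, (7.10)] -/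
def cε : ℝ := 2 - c.Lε
/-- The weight `𝔴_μ = σ s̄²` ((7.18)). [cite: Slade2017, (7.18)] -/
def wμ : ℝ := c.σ * c.sbar ^ 2
/-- The weight `𝔴_{y,j} = ω_j s̄` ((7.18)). [cite: Slade2017, (7.18)] -/
def wy (j : ℕ) : ℝ := c.omg j * c.sbar
/-- The weight `𝔴_K = λ_K s̄³` ((7.18)). [cite: Slade2017, (7.18)] -/
def wK : ℝ := c.lamK * c.sbar ^ 3
/-- The Lipschitz constant obtained for `T` on `B₁`: `1 - x/4`, `x = L^ε - 1 ∼ ε log L`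
(cf. (7.44): `1 - ¾ ε log L`). [cite: Slade2017, Theorem 7.2.2 ((7.44))] -/
def cLip : ℝ := 1 - c.xε / 4

/-- `L^ε = 1 + x`. [cite: Slade2017, §5.4] -/
theorem Lε_eq : c.Lε = 1 + c.xε := by simp [Consts.xε]

/-- `c_ε = 1 - x` (§5.4: "`c_ε = 2 - L^ε = 1 - x < 1` with `x = L^ε - 1`").
[cite: Slade2017, §5.4] -/
theorem cε_eq : c.cε = 1 - c.xε := by simp [Consts.cε, Consts.xε]; ring

/-- `ω_j = ζ ω_{j+1}` for `j < J_L` ((7.20)). [cite: Slade2017, (7.20)] -/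
theorem omg_eq_of_lt {j : ℕ} (hj : j < c.JL) : c.omg j = c.ζ * c.omg (j + 1) := by
  have : c.JL - j = (c.JL - (j + 1)) + 1 := by omega
  simp only [Consts.omg, this, pow_succ]; ring

/-- `ω_j = ω_{j+1}` for `j ≥ J_L` ("`ω_j = ω` when `j ≥ J_L`"). [cite: Slade2017, (7.20)] -/
theorem omg_eq_of_le {j : ℕ} (hj : c.JL ≤ j) : c.omg j = c.omg (j + 1) := by
  have h1 : c.JL - j = 0 := by omega
  have h2 : c.JL - (j + 1) = 0 := by omega
  simp only [Consts.omg, h1, h2]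

/-- `ω_{j+1} = ω = 1/32` for `j ≥ J_L`. [cite: Slade2017, (7.20)] -/
theorem omg_succ_eq_of_le {j : ℕ} (hj : c.JL ≤ j) : c.omg (j + 1) = 1 / 32 := by
  have h2 : c.JL - (j + 1) = 0 := by omega
  simp [Consts.omg, h2]

end Consts

section Defs

variable {W : ℕ → Type*} [∀ j, NormedAddCommGroup (W j)]

/-- Scale-dependent data of the map `T`: the coefficients `β_j`, `β^:_j`, `ξ̃_j` (newxi) of the
perturbative flow ((5.11), (5.17), (5.18)), the remainders `r_{μ,j}, r_{y,j}` and the map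
`Ǩ_{j+1}` of Lemma 7.1.1 as functions of `(μ_j, y_j, K_j)`, and the truncation weights `w_j`
(`1` for `j ≤ j_m̃`, `1 - δ_m̃` for `j = j_m̃ + 1`, `0` beyond; (7.22)–(7.26)).
[cite: Slade2017, Lemma 7.1.1, §7.2.2] -/
structure Data (W : ℕ → Type*) where
  β : ℕ → ℝ
  βW : ℕ → ℝ
  ξ : ℕ → ℝ
  rμ : (j : ℕ) → ℝ → ℝ → W j → ℝ
  ry : (j : ℕ) → ℝ → ℝ → W j → ℝ
  Kc : (j : ℕ) → ℝ → ℝ → W j → W (j + 1)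
  w : ℕ → ℝ

/-- The raw sequence space `Π_j (ℝ × ℝ × 𝒲_j)` of rescaled coordinates
`(a_j, b_j, k_j) = (μ_j/𝔴_μ, y_j/𝔴_{y,j}, K_j/𝔴_K)`. [cite: Slade2017, §7.2.1] -/
abbrev Seq (W : ℕ → Type*) := ∀ j : ℕ, ℝ × ℝ × W j

variable (c : Consts) (d : Data W) (y₀ : ℝ)

/-- `μ_j = 𝔴_μ · a_j`. [cite: Slade2017, (7.17)–(7.18)] -/
def μv (x : Seq W) (j : ℕ) : ℝ := c.wμ * (x j).1

/-- `y_j = 𝔴_{y,j} · b_j` for `j ≥ 1`, and the initial condition `y_0` (given).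
[cite: Slade2017, (7.17)–(7.18)] -/
def yv (x : Seq W) (j : ℕ) : ℝ := if j = 0 then y₀ else c.wy j * (x j).2.1

/-- `ρ_{μ,j}(μ, y) = -L^α (γ̂ β_j μ (s̄ - y) + ξ̃_j (s̄ - y)²)` ((7.11)).
[cite: Slade2017, (7.11)] -/
def ρμ (j : ℕ) (m y : ℝ) : ℝ :=
  -c.Lα * (c.γh * d.β j * m * (c.sbar - y) + d.ξ j * (c.sbar - y) ^ 2)

/-- The explicit part of the `y`-equation: `c_ε y + aL^ε y² + (β^:_j - a)L^ε (s̄ - y)²`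
((7.14), (7.23)). [cite: Slade2017, (7.14), (7.23)] -/
def Ymap (j : ℕ) (y : ℝ) : ℝ :=
  c.cε * y + c.a * c.Lε * y ^ 2 + (d.βW j - c.a) * c.Lε * (c.sbar - y) ^ 2

/-- The domain on which the bounds of Lemma 7.1.1 are required at scale `j`:
`|μ| ≤ σs̄²`, `|y| ≤ s̄/32 = ωs̄`, `‖K‖ ≤ λ_K s̄³` (cf. (7.9)). [cite: Slade2017, (7.9)] -/
def InDom {j : ℕ} (m y : ℝ) (K : W j) : Prop := |m| ≤ c.wμ ∧ |y| ≤ c.sbar / 32 ∧ ‖K‖ ≤ c.wK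

/-- **Hypotheses of Theorem 7.2.2 (inputs explicit).** Constants: `L^{-α} ≤ ¼` ("`L` large"),
`x = L^ε - 1 ∈ (0, 1/10]` and the smallness conditions `s₁`–`s₇`, `ζ_small` ("`ε` small
depending on `L`"), `a s̄ L^ε = x` ((5.31)), `γ̂ ∈ [0,1]`, `κ ≤ ¼` ((7.36)), and
`CK ≤ 8λ_K` (the constant of `‖D_y Ǩ‖`, which (7.35) takes equal to `C_RG = λ_K`). Data:
truncation weights in `[0,1]`; `|y_0| ≤ ω_0 s̄` and `‖K_0‖ ≤ λ_K s̄³` (Theorem 7.2.2: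
"`|y_0| ≤ ω_0 s̄`", `K_0 = 𝟙_∅`); `|β_j| ≤ B_β`, `|ξ̃_j| ≤ Π` (Lemma 5.2.1, (7.19)); Lemma 5.2.4
`|β^:_j - a| ≤ b_L` (`j < J_L`), `≤ a/64` (`J_L ≤ j`) at the active scales; and the bounds
(7.16) of Lemma 7.1.1 on the RG domain: `|r_*| ≤ O(s̄³)`, `|D_{μ,y} r_*| ≤ O(s̄²)`,
`‖D_K r_*‖ ≤ O(1)`, `‖D_{μ,y}Ǩ‖ ≤ O(s̄²)`, `‖D_K Ǩ‖ ≤ κ` (as Lipschitz bounds) and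
`‖Ǩ‖ ≤ C_RG s̄³` ((7.4)).
[cite: Slade2017, Theorem 7.2.2, Lemma 7.1.1, Lemma 5.2.1, Lemma 5.2.4, (5.31), (7.16)–(7.20)] -/
structure Hyp (c : Consts) (d : Data W) (y₀ : ℝ) (K₀ : W 0) : Prop where
  Lα_ge : 4 ≤ c.Lα
  x_pos : 0 < c.xε
  x_le : c.xε ≤ 1 / 10
  a_pos : 0 < c.a
  sbar_pos : 0 < c.sbar
  sbar_le : c.sbar ≤ 1
  fix : c.a * c.sbar * c.Lε = c.xε
  γh_nn : 0 ≤ c.γh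
  γh_le : c.γh ≤ 1
  Pxi_pos : 0 < c.Pxi
  Bβ_nn : 0 ≤ c.Bβ
  bL_nn : 0 ≤ c.bL
  lamK_pos : 0 < c.lamK
  κ_nn : 0 ≤ c.κ
  κ_le : c.κ ≤ 1 / 4
  C₀_nn : 0 ≤ c.C₀
  C₂_nn : 0 ≤ c.C₂
  C₃_nn : 0 ≤ c.C₃
  CK_nn : 0 ≤ c.CK
  CK_le : c.CK ≤ 8 * c.lamK
  ζ_small : 64 * (c.JL + 1) * c.bL * c.sbar ≤ 1 / 10
  s₁ : (6 * c.Bβ * c.Pxi + c.C₃) * c.sbar ≤ 2 * c.Pxi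
  s₂ : 100 * c.C₃ * c.sbar ≤ c.a
  s₃ : (2 * c.Bβ + c.C₂) * c.sbar ≤ 1 / 10
  s₄ : (c.C₂ + c.lamK * c.C₀) * c.sbar ≤ c.Pxi / 10
  s₅ : 100 * c.C₂ * c.sbar ≤ c.a
  s₆ : (2000 * c.Pxi * c.C₂ + 400 * c.lamK * c.C₀) * c.sbar ≤ c.a
  s₇ : 20 * c.Pxi * c.CK * c.sbar ≤ c.lamK
  w_nn : ∀ j, 0 ≤ d.w j
  w_le : ∀ j, d.w j ≤ 1
  y₀_le : |y₀| ≤ c.wy 0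
  K₀_le : ‖K₀‖ ≤ c.wK
  β_le : ∀ j, |d.β j| ≤ c.Bβ
  ξ_le : ∀ j, |d.ξ j| ≤ c.Pxi
  βW_le₁ : ∀ j, d.w (j + 1) ≠ 0 → j < c.JL → |d.βW j - c.a| ≤ c.bL
  βW_le₂ : ∀ j, d.w (j + 1) ≠ 0 → c.JL ≤ j → |d.βW j - c.a| ≤ c.a / 64
  rμ_le : ∀ j m y (K : W j), InDom c m y K → |d.rμ j m y K| ≤ c.C₃ * c.sbar ^ 3
  ry_le : ∀ j m y (K : W j), InDom c m y K → |d.ry j m y K| ≤ c.C₃ * c.sbar ^ 3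
  Kc_le : ∀ j m y (K : W j), InDom c m y K → ‖d.Kc j m y K‖ ≤ c.wK
  rμ_lip : ∀ j m y (K : W j) m' y' (K' : W j), InDom c m y K → InDom c m' y' K' →
    |d.rμ j m y K - d.rμ j m' y' K'| ≤
      c.C₂ * c.sbar ^ 2 * (|m - m'| + |y - y'|) + c.C₀ * ‖K - K'‖
  ry_lip : ∀ j m y (K : W j) m' y' (K' : W j), InDom c m y K → InDom c m' y' K' →
    |d.ry j m y K - d.ry j m' y' K'| ≤
      c.C₂ * c.sbar ^ 2 * (|m - m'| + |y - y'|) + c.C₀ * ‖K - K'‖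
  Kc_lip : ∀ j m y (K : W j) m' y' (K' : W j), InDom c m y K → InDom c m' y' K' →
    ‖d.Kc j m y K - d.Kc j m' y' K'‖ ≤
      c.CK * c.sbar ^ 2 * (|m - m'| + |y - y'|) + c.κ * ‖K - K'‖

variable {c d y₀}

omit [∀ j, NormedAddCommGroup (W j)] in
/-- `y_0` is the given initial condition. [cite: Slade2017, §7.2.1] -/
theorem yv_zero (x : Seq W) : yv c y₀ x 0 = y₀ := by simp [yv]

omit [∀ j, NormedAddCommGroup (W j)] in
/-- `y_{j+1} = 𝔴_{y,j+1} b_{j+1}`. [cite: Slade2017, (7.17)–(7.18)] -/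
theorem yv_succ (x : Seq W) (j : ℕ) : yv c y₀ x (j + 1) = c.wy (j + 1) * (x (j + 1)).2.1 := by
  simp [yv]

/-- The first component is bounded by the (maximum) norm of the triple. [folklore] -/
theorem abs_fst_le_norm {j : ℕ} (v : ℝ × ℝ × W j) : |v.1| ≤ ‖v‖ := by
  rw [← Real.norm_eq_abs]; exact norm_fst_le v

/-- The second component is bounded by the (maximum) norm of the triple. [folklore] -/
theorem abs_snd_le_norm {j : ℕ} (v : ℝ × ℝ × W j) : |v.2.1| ≤ ‖v‖ := by
  rw [← Real.norm_eq_abs]; exact (norm_fst_le v.2).trans (norm_snd_le v)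

/-- The third component is bounded by the (maximum) norm of the triple. [folklore] -/
theorem norm_thd_le_norm {j : ℕ} (v : ℝ × ℝ × W j) : ‖v.2.2‖ ≤ ‖v‖ :=
  (norm_snd_le v.2).trans (norm_snd_le v)

/-- The maximum norm of a triple is bounded by a common bound on the components. [folklore] -/
theorem norm_triple_le {j : ℕ} {v : ℝ × ℝ × W j} {C : ℝ} (h₁ : |v.1| ≤ C) (h₂ : |v.2.1| ≤ C)
    (h₃ : ‖v.2.2‖ ≤ C) : ‖v‖ ≤ C := by
  rw [Prod.norm_def, Prod.norm_def, Real.norm_eq_abs, Real.norm_eq_abs]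
  exact max_le h₁ (max_le h₂ h₃)

/-- Difference of first components is bounded by the distance of the triples. [folklore] -/
theorem abs_fst_sub_le {j : ℕ} (v v' : ℝ × ℝ × W j) : |v.1 - v'.1| ≤ dist v v' := by
  rw [dist_eq_norm, ← Prod.fst_sub]; exact abs_fst_le_norm _

/-- Difference of second components is bounded by the distance of the triples. [folklore] -/
theorem abs_snd_sub_le {j : ℕ} (v v' : ℝ × ℝ × W j) : |v.2.1 - v'.2.1| ≤ dist v v' := by
  rw [dist_eq_norm, ← Prod.fst_sub, ← Prod.snd_sub]; exact abs_snd_le_norm _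

/-- Difference of third components is bounded by the distance of the triples. [folklore] -/
theorem norm_thd_sub_le {j : ℕ} (v v' : ℝ × ℝ × W j) : ‖v.2.2 - v'.2.2‖ ≤ dist v v' := by
  rw [dist_eq_norm, ← Prod.snd_sub, ← Prod.snd_sub]; exact norm_thd_le_norm _

namespace Hyp

variable {K₀ : W 0} (h : Hyp c d y₀ K₀)
include h

/-- `L^ε > 0`. [cite: Slade2017, §5.4] -/
theorem Lε_pos : 0 < c.Lε := by rw [c.Lε_eq]; linarith [h.x_pos]

/-- `L^ε ≤ 11/10` (`ε` small). [cite: Slade2017, §5.4] -/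
theorem Lε_le : c.Lε ≤ 11 / 10 := by rw [c.Lε_eq]; linarith [h.x_le]

/-- `L^ε ≥ 1`. [cite: Slade2017, §5.4] -/
theorem one_le_Lε : 1 ≤ c.Lε := by rw [c.Lε_eq]; linarith [h.x_pos]

/-- `c_ε ≥ 0`. [cite: Slade2017, §5.4] -/
theorem cε_nonneg : 0 ≤ c.cε := by rw [c.cε_eq]; linarith [h.x_le]

/-- `L^α > 0`. [cite: Slade2017, §7.2] -/
theorem Lα_pos : 0 < c.Lα := by linarith [h.Lα_ge]

/-- `L^{-α} ≤ ¼` (`L` large). [cite: Slade2017, §7.2] -/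
theorem Lα_inv_le : c.Lα⁻¹ ≤ 1 / 4 := by
  rw [inv_eq_one_div]; exact div_le_div_of_nonneg_left zero_le_one (by norm_num) h.Lα_ge

/-- `L^{-α} ≥ 0`. [cite: Slade2017, §7.2] -/
theorem Lα_inv_nonneg : 0 ≤ c.Lα⁻¹ := inv_nonneg.2 h.Lα_pos.le

/-- `aL^εs̄ = x` ((5.31): `s̄ = a⁻¹(1 - L^{-ε})`). [cite: Slade2017, (5.31)] -/
theorem axs : c.a * c.Lε * c.sbar = c.xε := by rw [← h.fix]; ring

/-- `a s̄ ≤ x`. [cite: Slade2017, (5.31)] -/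
theorem as_le : c.a * c.sbar ≤ c.xε := by
  rw [← h.axs, c.Lε_eq]; nlinarith [mul_pos h.a_pos h.sbar_pos, h.x_pos]

/-- `64 b_L s̄ ≤ 1/10` (`ε` small depending on `L`). [cite: Slade2017, §7.2.1] -/
theorem u_le : 64 * c.bL * c.sbar ≤ 1 / 10 := by
  have h1 := h.ζ_small
  have h2 : 0 ≤ 64 * c.JL * c.bL * c.sbar := by
    have := h.bL_nn; have := h.sbar_pos.le; positivity
  nlinarith

/-- `b_L s̄ ≥ 0`. [cite: Slade2017, §7.2.1] -/
theorem u_nonneg : 0 ≤ c.bL * c.sbar := mul_nonneg h.bL_nn h.sbar_pos.le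

/-- `ζ = 1 - 64b_Ls̄ ≥ 9/10`. [cite: Slade2017, §7.2.1] -/
theorem ζ_ge : 9 / 10 ≤ c.ζ := by have := h.u_le; simp only [Consts.ζ]; linarith

/-- `ζ > 0`. [cite: Slade2017, §7.2.1] -/
theorem ζ_pos : 0 < c.ζ := by linarith [h.ζ_ge]

/-- `ζ ≤ 1`. [cite: Slade2017, §7.2.1] -/
theorem ζ_le_one : c.ζ ≤ 1 := by
  have := h.u_nonneg; simp only [Consts.ζ]; nlinarith

/-- `ζ^n ≥ 9/10` for `n ≤ J_L` ("`ζ^{J_L} = 1 - O(ε)`"; Bernoulli's inequality). [cite: Slade2017,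
§7.2.1 (after (7.20))] -/
theorem ζ_pow_ge (n : ℕ) (hn : n ≤ c.JL) : 9 / 10 ≤ c.ζ ^ n := by
  have hB : 1 + (n : ℝ) * (-(64 * c.bL * c.sbar)) ≤ (1 + -(64 * c.bL * c.sbar)) ^ n :=
    one_add_mul_le_pow (by linarith [h.u_le, h.u_nonneg]) n
  have hζ : c.ζ = 1 + -(64 * c.bL * c.sbar) := by simp only [Consts.ζ]; ring
  rw [hζ]
  refine le_trans ?_ hB
  have hn' : (n : ℝ) ≤ c.JL := by exact_mod_cast hn
  have h1 := h.ζ_small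
  have hbs : 0 ≤ 64 * c.bL * c.sbar := by linarith [h.u_nonneg]
  have : (n : ℝ) * (64 * c.bL * c.sbar) ≤ 1 / 10 :=
    calc (n : ℝ) * (64 * c.bL * c.sbar) ≤ (c.JL + 1) * (64 * c.bL * c.sbar) := by
          apply mul_le_mul_of_nonneg_right _ hbs; linarith
      _ = 64 * (c.JL + 1) * c.bL * c.sbar := by ring
      _ ≤ 1 / 10 := h1
  linarith

/-- `ω_j > 0`. [cite: Slade2017, (7.20)] -/
theorem omg_pos (j : ℕ) : 0 < c.omg j := by
  have := pow_pos h.ζ_pos (c.JL - j); simp only [Consts.omg]; positivity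

/-- `ω_j ≤ ω = 1/32` ((7.21): `ω_0 ≤ ω_j ≤ ω`). [cite: Slade2017, (7.21)] -/
theorem omg_le (j : ℕ) : c.omg j ≤ 1 / 32 := by
  have : c.ζ ^ (c.JL - j) ≤ 1 := pow_le_one₀ h.ζ_pos.le h.ζ_le_one
  simp only [Consts.omg]; linarith

/-- `ω_j ≥ (9/10)ω` ((7.21) with `ζ^{J_L} ≥ 9/10`). [cite: Slade2017, (7.21)] -/
theorem omg_ge (j : ℕ) : 9 / 320 ≤ c.omg j := by
  have := h.ζ_pow_ge (c.JL - j) (Nat.sub_le _ _)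
  simp only [Consts.omg]; linarith

/-- `σ = 5Π > 0`. [cite: Slade2017, (7.19)] -/
theorem σ_pos : 0 < c.σ := by have := h.Pxi_pos; simp only [Consts.σ]; positivity

/-- `𝔴_μ > 0`. [cite: Slade2017, (7.18)] -/
theorem wμ_pos : 0 < c.wμ := by
  have := h.σ_pos; have := h.sbar_pos; simp only [Consts.wμ]; positivity

/-- `𝔴_{y,j} > 0`. [cite: Slade2017, (7.18)] -/
theorem wy_pos (j : ℕ) : 0 < c.wy j := by
  have := h.omg_pos j; have := h.sbar_pos; simp only [Consts.wy]; positivity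

/-- `𝔴_K > 0`. [cite: Slade2017, (7.18)] -/
theorem wK_pos : 0 < c.wK := by
  have := h.lamK_pos; have := h.sbar_pos; simp only [Consts.wK]; positivity

/-- `𝔴_{y,j} ≤ s̄/32`. [cite: Slade2017, (7.18), (7.21)] -/
theorem wy_le (j : ℕ) : c.wy j ≤ c.sbar / 32 := by
  have := h.omg_le j; have := h.sbar_pos
  simp only [Consts.wy]; nlinarith

/-- The contraction ratio is `< 1`. [cite: Slade2017, Theorem 7.2.2] -/
theorem cLip_lt_one : c.cLip < 1 := by have := h.x_pos; simp only [Consts.cLip]; linarith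

/-- The contraction ratio is `≥ 0`. [cite: Slade2017, Theorem 7.2.2] -/
theorem cLip_nonneg : 0 ≤ c.cLip := by have := h.x_le; simp only [Consts.cLip]; linarith

/-- On `B₁`: `|μ_j| ≤ σs̄²` ((7.26)). [cite: Slade2017, Theorem 7.2.2 (proof, first display)] -/
theorem abs_μv_le {x : Seq W} {j : ℕ} (hx : ‖x j‖ ≤ 1) : |μv c x j| ≤ c.wμ := by
  have h1 : |(x j).1| ≤ 1 := (abs_fst_le_norm _).trans hx
  have := h.wμ_pos
  rw [μv, abs_mul, abs_of_pos h.wμ_pos]; nlinarith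

/-- On `B₁`: `|y_j| ≤ ω_js̄` ((7.26); `|y_0| ≤ ω_0s̄` by hypothesis). [cite: Slade2017, Theorem
7.2.2 (proof, first display)] -/
theorem abs_yv_le {x : Seq W} {j : ℕ} (hx : ‖x j‖ ≤ 1) : |yv c y₀ x j| ≤ c.wy j := by
  rcases j with _ | j
  · rw [yv_zero]; exact h.y₀_le
  · have h1 : |(x (j + 1)).2.1| ≤ 1 := (abs_snd_le_norm _).trans hx
    have := h.wy_pos (j + 1)
    rw [yv_succ, abs_mul, abs_of_pos (h.wy_pos _)]; nlinarith

/-- On `B₁`: `|y_j| ≤ ωs̄ = s̄/32`. [cite: Slade2017, Theorem 7.2.2 (proof, first display)] -/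
theorem abs_yv_le' {x : Seq W} {j : ℕ} (hx : ‖x j‖ ≤ 1) : |yv c y₀ x j| ≤ c.sbar / 32 :=
  (h.abs_yv_le hx).trans (h.wy_le j)

/-- `|ρ_{μ,j}| ≤ L^α (B_β σ s̄² · (33/32)s̄ + Π (33/32)² s̄²)` on the domain.
[cite: Slade2017, (7.11), (7.27)] -/
theorem abs_ρμ_le {j : ℕ} {m y : ℝ} (hm : |m| ≤ c.wμ) (hy : |y| ≤ c.sbar / 32) :
    |ρμ c d j m y| ≤
      c.Lα * (c.Bβ * c.wμ * (33 / 32 * c.sbar) + c.Pxi * (33 / 32 * c.sbar) ^ 2) := by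
  have hsy : |c.sbar - y| ≤ 33 / 32 * c.sbar := by
    have := abs_sub c.sbar y
    rw [abs_of_pos h.sbar_pos] at this; linarith
  have hsy0 : 0 ≤ |c.sbar - y| := abs_nonneg _
  have hB := h.Bβ_nn
  have hwμ := h.wμ_pos
  have h1 : |c.γh * d.β j * m * (c.sbar - y)| ≤ c.Bβ * c.wμ * (33 / 32 * c.sbar) := by
    rw [abs_mul, abs_mul, abs_mul, abs_of_nonneg h.γh_nn]
    have a1 : c.γh * |d.β j| ≤ 1 * c.Bβ := mul_le_mul h.γh_le (h.β_le j) (abs_nonneg _) zero_le_one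
    have a2 : c.γh * |d.β j| * |m| ≤ 1 * c.Bβ * c.wμ :=
      mul_le_mul a1 hm (abs_nonneg _) (by positivity)
    have a3 : c.γh * |d.β j| * |m| * |c.sbar - y| ≤ 1 * c.Bβ * c.wμ * (33 / 32 * c.sbar) :=
      mul_le_mul a2 hsy hsy0 (by positivity)
    simpa only [one_mul] using a3
  have h2 : |d.ξ j * (c.sbar - y) ^ 2| ≤ c.Pxi * (33 / 32 * c.sbar) ^ 2 := by
    rw [abs_mul, abs_pow]
    exact mul_le_mul (h.ξ_le j) (pow_le_pow_left₀ hsy0 hsy 2) (by positivity) h.Pxi_pos.le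
  rw [ρμ, abs_mul, abs_neg, abs_of_pos h.Lα_pos]
  exact mul_le_mul_of_nonneg_left ((abs_add_le _ _).trans (add_le_add h1 h2)) h.Lα_pos.le

/-- `|c_ε y + aL^ε y²| ≤ ω_j s̄ (1 - x(1 - ω_j))` for `|y| ≤ ω_j s̄` (first two terms of (7.29)).
[cite: Slade2017, (7.29)] -/
theorem abs_quad_le {y : ℝ} {j : ℕ} (hy : |y| ≤ c.wy j) :
    |c.cε * y + c.a * c.Lε * y ^ 2| ≤ c.wy j * (1 - c.xε * (1 - c.omg j)) := by
  have hcε := h.cε_nonneg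
  have haL : 0 ≤ c.a * c.Lε := (mul_pos h.a_pos h.Lε_pos).le
  have hfac : c.cε * y + c.a * c.Lε * y ^ 2 = y * (c.cε + c.a * c.Lε * y) := by ring
  rw [hfac, abs_mul]
  have h1 : |c.cε + c.a * c.Lε * y| ≤ c.cε + c.a * c.Lε * |y| := by
    refine (abs_add_le _ _).trans ?_
    rw [abs_of_nonneg hcε, abs_mul, abs_of_nonneg haL]
  have hwy := h.wy_pos j
  have h2 : c.a * c.Lε * c.wy j = c.xε * c.omg j := by
    simp only [Consts.wy]; rw [← h.axs]; ring
  calc |y| * |c.cε + c.a * c.Lε * y| ≤ c.wy j * (c.cε + c.a * c.Lε * c.wy j) := by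
        apply mul_le_mul hy (h1.trans _) (abs_nonneg _) hwy.le
        exact add_le_add le_rfl (mul_le_mul_of_nonneg_left hy haL)
    _ = c.wy j * (1 - c.xε * (1 - c.omg j)) := by rw [h2, c.cε_eq]; ring

/-- `|Ymap_j(y)| ≤ ω_j s̄(1 - x(1-ω_j)) + |β^:_j - a| L^ε (33/32)² s̄²` for `|y| ≤ ω_j s̄`.
[cite: Slade2017, (7.29)] -/
theorem abs_Ymap_le {y : ℝ} {j : ℕ} (hy : |y| ≤ c.wy j) :
    |Ymap c d j y| ≤ c.wy j * (1 - c.xε * (1 - c.omg j))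
      + |d.βW j - c.a| * c.Lε * (33 / 32 * c.sbar) ^ 2 := by
  have hsy : |c.sbar - y| ≤ 33 / 32 * c.sbar := by
    have := abs_sub c.sbar y
    have hy' := hy.trans (h.wy_le j)
    rw [abs_of_pos h.sbar_pos] at this; linarith
  rw [Ymap]
  refine (abs_add_le _ _).trans (add_le_add (h.abs_quad_le hy) ?_)
  rw [abs_mul, abs_mul, abs_of_pos h.Lε_pos, abs_pow]
  exact mul_le_mul_of_nonneg_left (pow_le_pow_left₀ (abs_nonneg _) hsy 2)
    (mul_nonneg (abs_nonneg _) h.Lε_pos.le)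

/-- Lipschitz bound for `Ymap_j` on `|y|, |y'| ≤ ω_j s̄`:
`|Ymap_j(y) - Ymap_j(y')| ≤ (c_ε + 2xω_j + 2|β^:_j - a|L^ε(1 + ω_j)s̄)|y - y'|` ((7.39)).
[cite: Slade2017, (7.39)] -/
theorem abs_Ymap_sub_le {y y' : ℝ} {j : ℕ} (hy : |y| ≤ c.wy j) (hy' : |y'| ≤ c.wy j) :
    |Ymap c d j y - Ymap c d j y'| ≤
      (1 - c.xε + 2 * c.xε * c.omg j + 2 * |d.βW j - c.a| * c.Lε * (33 / 32 * c.sbar))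
        * |y - y'| := by
  have hcε := h.cε_nonneg
  have haL : 0 ≤ c.a * c.Lε := (mul_pos h.a_pos h.Lε_pos).le
  have hfac : Ymap c d j y - Ymap c d j y' =
      (c.cε + c.a * c.Lε * (y + y') - (d.βW j - c.a) * c.Lε * (2 * c.sbar - y - y'))
        * (y - y') := by
    simp only [Ymap]; ring
  rw [hfac, abs_mul]
  refine mul_le_mul_of_nonneg_right ?_ (abs_nonneg _)
  have hyy : |y + y'| ≤ 2 * c.wy j := by
    have := abs_add_le y y'; linarith
  have hs2 : |2 * c.sbar - y - y'| ≤ 2 * (33 / 32 * c.sbar) := by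
    have h1 : |2 * c.sbar - y - y'| ≤ |2 * c.sbar| + |y| + |y'| := by
      have := abs_sub (2 * c.sbar - y) y'
      have := abs_sub (2 * c.sbar) y
      linarith
    have := h.wy_le j
    have e : |2 * c.sbar| = 2 * c.sbar := abs_of_pos (by linarith [h.sbar_pos])
    rw [e] at h1; linarith
  have h2 : c.a * c.Lε * c.wy j = c.xε * c.omg j := by
    simp only [Consts.wy]; rw [← h.axs]; ring
  calc |c.cε + c.a * c.Lε * (y + y') - (d.βW j - c.a) * c.Lε * (2 * c.sbar - y - y')|
      ≤ |c.cε| + |c.a * c.Lε * (y + y')| + |(d.βW j - c.a) * c.Lε * (2 * c.sbar - y - y')| :=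
        (abs_sub _ _).trans (add_le_add (abs_add_le _ _) le_rfl)
    _ ≤ c.cε + c.a * c.Lε * (2 * c.wy j) + |d.βW j - c.a| * c.Lε * (2 * (33 / 32 * c.sbar)) := by
        rw [abs_of_nonneg hcε, abs_mul, abs_of_nonneg haL, abs_mul, abs_mul,
          abs_of_pos h.Lε_pos]
        exact add_le_add (add_le_add le_rfl (mul_le_mul_of_nonneg_left hyy haL))
          (mul_le_mul_of_nonneg_left hs2 (mul_nonneg (abs_nonneg _) h.Lε_pos.le))
    _ = 1 - c.xε + 2 * c.xε * c.omg j + 2 * |d.βW j - c.a| * c.Lε * (33 / 32 * c.sbar) := by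
        rw [c.cε_eq]
        have : c.a * c.Lε * (2 * c.wy j) = 2 * (c.a * c.Lε * c.wy j) := by ring
        rw [this, h2]; ring


/-! ### Differences of the physical coordinates of two points of `B₁` -/

/-- `|μ_j - μ'_j| ≤ 𝔴_μ ‖x - x'‖`. [cite: Slade2017, (7.17)–(7.18)] -/
theorem abs_μv_sub_le {x x' : Seq W} {D : ℝ} (hD : ∀ j, dist (x j) (x' j) ≤ D) (j : ℕ) :
    |μv c x j - μv c x' j| ≤ c.wμ * D := by
  have h1 := (abs_fst_sub_le (x j) (x' j)).trans (hD j)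
  rw [μv, μv, ← mul_sub, abs_mul, abs_of_pos h.wμ_pos]
  exact mul_le_mul_of_nonneg_left h1 h.wμ_pos.le

/-- `|y_j - y'_j| ≤ 𝔴_{y,j} ‖x - x'‖` (zero at `j = 0`). [cite: Slade2017, (7.17)–(7.18)] -/
theorem abs_yv_sub_le {x x' : Seq W} {D : ℝ} (hD : ∀ j, dist (x j) (x' j) ≤ D) (j : ℕ) :
    |yv c y₀ x j - yv c y₀ x' j| ≤ c.wy j * D := by
  have hD0 : 0 ≤ D := dist_nonneg.trans (hD 0)
  rcases j with _ | j
  · rw [yv_zero, yv_zero, sub_self, abs_zero]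
    exact mul_nonneg (h.wy_pos 0).le hD0
  · have h1 := (abs_snd_sub_le (x (j + 1)) (x' (j + 1))).trans (hD (j + 1))
    rw [yv_succ, yv_succ, ← mul_sub, abs_mul, abs_of_pos (h.wy_pos _)]
    exact mul_le_mul_of_nonneg_left h1 (h.wy_pos _).le

/-- `|y_j - y'_j| ≤ (s̄/32) ‖x - x'‖`. [cite: Slade2017, (7.17)–(7.18)] -/
theorem abs_yv_sub_le' {x x' : Seq W} {D : ℝ} (hD : ∀ j, dist (x j) (x' j) ≤ D) (j : ℕ) :
    |yv c y₀ x j - yv c y₀ x' j| ≤ c.sbar / 32 * D :=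
  (h.abs_yv_sub_le hD j).trans
    (mul_le_mul_of_nonneg_right (h.wy_le j) (dist_nonneg.trans (hD 0)))

/-- `|ρ_{μ,j}(μ,y) - ρ_{μ,j}(μ',y')| ≤ L^α (B_β((33/32)s̄|μ-μ'| + σs̄²|y-y'|) + Π(33/16)s̄|y-y'|)`.
[cite: Slade2017, (7.11)] -/
theorem abs_ρμ_sub_le {x x' : Seq W} {D : ℝ} (hx : ∀ j, ‖x j‖ ≤ 1) (hx' : ∀ j, ‖x' j‖ ≤ 1)
    (hD : ∀ j, dist (x j) (x' j) ≤ D) (j : ℕ) :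
    |ρμ c d j (μv c x j) (yv c y₀ x j) - ρμ c d j (μv c x' j) (yv c y₀ x' j)| ≤
      c.Lα * (c.Bβ * (33 / 32 * c.sbar * (c.wμ * D) + c.wμ * (c.sbar / 32 * D))
        + c.Pxi * (33 / 16 * c.sbar) * (c.sbar / 32 * D)) := by
  have hD0 : 0 ≤ D := dist_nonneg.trans (hD 0)
  set m := μv c x j; set m' := μv c x' j; set y := yv c y₀ x j; set y' := yv c y₀ x' j
  have hm' : |m'| ≤ c.wμ := h.abs_μv_le (hx' j)
  have hy : |y| ≤ c.sbar / 32 := h.abs_yv_le' (hx j)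
  have hy' : |y'| ≤ c.sbar / 32 := h.abs_yv_le' (hx' j)
  have hdm : |m - m'| ≤ c.wμ * D := h.abs_μv_sub_le hD j
  have hdy : |y - y'| ≤ c.sbar / 32 * D := h.abs_yv_sub_le' hD j
  have hs := h.sbar_pos
  have hwμ := h.wμ_pos
  have hsy : |c.sbar - y| ≤ 33 / 32 * c.sbar := by
    have := abs_sub c.sbar y; rw [abs_of_pos hs] at this; linarith
  have hs2 : |2 * c.sbar - y - y'| ≤ 33 / 16 * c.sbar := by
    have h1 : |2 * c.sbar - y - y'| ≤ |2 * c.sbar| + |y| + |y'| := by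
      have := abs_sub (2 * c.sbar - y) y'
      have := abs_sub (2 * c.sbar) y
      linarith
    have e : |2 * c.sbar| = 2 * c.sbar := abs_of_pos (by linarith)
    rw [e] at h1; linarith
  have hfac : ρμ c d j m y - ρμ c d j m' y' =
      -c.Lα * (c.γh * d.β j * ((m - m') * (c.sbar - y) - m' * (y - y'))
        + d.ξ j * (-(y - y') * (2 * c.sbar - y - y'))) := by
    simp only [ρμ]; ring
  rw [hfac, abs_mul, abs_neg, abs_of_pos h.Lα_pos]
  refine mul_le_mul_of_nonneg_left ((abs_add_le _ _).trans (add_le_add ?_ ?_)) h.Lα_pos.le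
  · rw [abs_mul, abs_mul, abs_of_nonneg h.γh_nn]
    have a1 : c.γh * |d.β j| ≤ c.Bβ := by
      have := mul_le_mul h.γh_le (h.β_le j) (abs_nonneg _) zero_le_one
      simpa using this
    have a2 : |(m - m') * (c.sbar - y) - m' * (y - y')| ≤
        33 / 32 * c.sbar * (c.wμ * D) + c.wμ * (c.sbar / 32 * D) := by
      refine (abs_sub _ _).trans (add_le_add ?_ ?_)
      · rw [abs_mul, mul_comm]
        exact mul_le_mul hsy hdm (abs_nonneg _) (by positivity)
      · rw [abs_mul]; exact mul_le_mul hm' hdy (abs_nonneg _) hwμ.le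
    exact mul_le_mul a1 a2 (abs_nonneg _) h.Bβ_nn
  · rw [abs_mul, abs_mul, abs_neg]
    have a2 : |y - y'| * |2 * c.sbar - y - y'| ≤ c.sbar / 32 * D * (33 / 16 * c.sbar) :=
      mul_le_mul hdy hs2 (abs_nonneg _) (by positivity)
    calc |d.ξ j| * (|y - y'| * |2 * c.sbar - y - y'|)
        ≤ c.Pxi * (c.sbar / 32 * D * (33 / 16 * c.sbar)) :=
          mul_le_mul (h.ξ_le j) a2 (by positivity) h.Pxi_pos.le
      _ = _ := by ring

/-- The cross terms of the `y`-row: `C₂s̄²(σs̄² + s̄/32)D + C₀λ_Ks̄³D ≤ (9/320)s̄D · (7/20)x`.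
[cite: Slade2017, (7.37)–(7.38)] -/
theorem cross_le {x x' : Seq W} {D : ℝ} (hD : ∀ j, dist (x j) (x' j) ≤ D) :
    c.C₂ * c.sbar ^ 2 * (c.wμ * D + c.sbar / 32 * D) + c.C₀ * (c.wK * D) ≤
    9 / 320 * c.sbar * D * (7 / 20 * c.xε) := by
  have hD0 : 0 ≤ D := dist_nonneg.trans (hD 0)
  have hs := h.sbar_pos; have hs1 := h.sbar_le; have ha := h.a_pos
  have hP := h.Pxi_pos; have hC2 := h.C₂_nn; have hC0 := h.C₀_nn; have hlam := h.lamK_pos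
  have has := h.as_le; have hs5 := h.s₅; have hs6 := h.s₆; have hx0 := h.x_pos
  simp only [Consts.wμ, Consts.σ, Consts.wK]
  have e : c.C₂ * c.sbar ^ 2 * (5 * c.Pxi * c.sbar ^ 2 * D + c.sbar / 32 * D)
      + c.C₀ * (c.lamK * c.sbar ^ 3 * D)
      = c.sbar * D * (c.sbar * ((5 * c.Pxi * c.C₂ * c.sbar) * c.sbar + c.C₂ * c.sbar / 32
        + c.lamK * c.C₀ * c.sbar)) := by ring
  have goal_eq : 9 / 320 * c.sbar * D * (7 / 20 * c.xε) = c.sbar * D * (63 / 6400 * c.xε) := by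
    ring
  rw [e, goal_eq]
  refine mul_le_mul_of_nonneg_left ?_ (by positivity)
  have hs6' : 2000 * c.Pxi * c.C₂ * c.sbar + 400 * c.lamK * c.C₀ * c.sbar ≤ c.a := by
    have e' : 2000 * c.Pxi * c.C₂ * c.sbar + 400 * c.lamK * c.C₀ * c.sbar =
        (2000 * c.Pxi * c.C₂ + 400 * c.lamK * c.C₀) * c.sbar := by ring
    rw [e']; exact hs6
  have hPC : 0 ≤ c.Pxi * c.C₂ * c.sbar := by positivity
  have hLC : 0 ≤ c.lamK * c.C₀ * c.sbar := by positivity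
  have e1 : 5 * c.Pxi * c.C₂ * c.sbar ≤ c.a / 400 := by linarith
  have e2 : c.lamK * c.C₀ * c.sbar ≤ c.a / 400 := by linarith
  have e3 : c.C₂ * c.sbar ≤ c.a / 100 := by linarith
  have e4 : (5 * c.Pxi * c.C₂ * c.sbar) * c.sbar ≤ c.a / 400 := by
    have : (5 * c.Pxi * c.C₂ * c.sbar) * c.sbar ≤ (5 * c.Pxi * c.C₂ * c.sbar) * 1 :=
      mul_le_mul_of_nonneg_left hs1 (by positivity)
    linarith
  have inner : (5 * c.Pxi * c.C₂ * c.sbar) * c.sbar + c.C₂ * c.sbar / 32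
      + c.lamK * c.C₀ * c.sbar ≤ 17 / 3200 * c.a := by linarith
  calc c.sbar * ((5 * c.Pxi * c.C₂ * c.sbar) * c.sbar + c.C₂ * c.sbar / 32
        + c.lamK * c.C₀ * c.sbar) ≤ c.sbar * (17 / 3200 * c.a) :=
        mul_le_mul_of_nonneg_left inner hs.le
    _ = 17 / 3200 * (c.a * c.sbar) := by ring
    _ ≤ 63 / 6400 * c.xε := by linarith

end Hyp

end Defs

section Rows

variable {W : ℕ → Type*} [∀ j, NormedAddCommGroup (W j)] [∀ j, NormedSpace ℝ (W j)]
variable (c : Consts) (d : Data W) (y₀ : ℝ) (K₀ : W 0)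

/-- `K_j = 𝔴_K · k_j` for `j ≥ 1`, and the initial condition `K_0` (given).
[cite: Slade2017, (7.17)–(7.18)] -/
def Kv (x : Seq W) : (j : ℕ) → W j
  | 0 => K₀
  | j + 1 => c.wK • (x (j + 1)).2.2

/-- The `μ`-row of `T̂`: `L^{-α}(μ_{j+1} - ρ_{μ,j} - r_{μ,j})` ((7.22)).
[cite: Slade2017, (7.22)] -/
def rowμ (x : Seq W) (j : ℕ) : ℝ :=
  c.Lα⁻¹ * (μv c x (j + 1) - ρμ c d j (μv c x j) (yv c y₀ x j)
    - d.rμ j (μv c x j) (yv c y₀ x j) (Kv c K₀ x j))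

/-- The `y`-row of `T̂`: `(T̂⁽ʸ⁾x)_{j+1} = Ymap_j(y_j) + r_{y,j}` ((7.23)); row `0` is a dummy.
[cite: Slade2017, (7.23)] -/
def rowy (x : Seq W) : ℕ → ℝ
  | 0 => 0
  | j + 1 => Ymap c d j (yv c y₀ x j) + d.ry j (μv c x j) (yv c y₀ x j) (Kv c K₀ x j)

/-- The `K`-row of `T̂`: `(T̂⁽ᴷ⁾x)_{j+1} = Ǩ_{j+1}(μ_j, y_j, K_j)` ((7.24)); row `0` is a dummy.
[cite: Slade2017, (7.24)] -/
def rowK (x : Seq W) : (j : ℕ) → W j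
  | 0 => 0
  | j + 1 => d.Kc j (μv c x j) (yv c y₀ x j) (Kv c K₀ x j)

/-- The map `T` of §7.2.2 in rescaled coordinates, rows multiplied by the truncation weights
`w_j` ((7.22)–(7.26)). [cite: Slade2017, §7.2.2 ((7.22)–(7.27))] -/
def Trow (x : Seq W) (j : ℕ) : ℝ × ℝ × W j :=
  (d.w j * rowμ c d y₀ K₀ x j / c.wμ, d.w j * rowy c d y₀ K₀ x j / c.wy j,
    (d.w j / c.wK) • rowK c d y₀ K₀ x j)

variable {c d y₀ K₀}

/-- Row `0` of `T̂⁽ʸ⁾` is a dummy (the `y`-coordinates of `X` start at `j = 1`). [cite: Slade2017,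
§7.2.1] -/
theorem rowy_zero (x : Seq W) : rowy c d y₀ K₀ x 0 = 0 := rfl

/-- (7.23): `(T̂⁽ʸ⁾x)_{j+1} = c_εy_j + aL^εy_j² + (β^:_j - a)L^ε(s̄ - y_j)² + r_{y,j}`. [cite:
Slade2017, (7.23)] -/
theorem rowy_succ (x : Seq W) (j : ℕ) : rowy c d y₀ K₀ x (j + 1) =
    Ymap c d j (yv c y₀ x j) + d.ry j (μv c x j) (yv c y₀ x j) (Kv c K₀ x j) := rfl

/-- Row `0` of `T̂⁽ᴷ⁾` is a dummy (the `K`-coordinates of `X` start at `j = 1`). [cite: Slade2017,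
§7.2.1] -/
theorem rowK_zero (x : Seq W) : rowK c d y₀ K₀ x 0 = 0 := rfl

/-- (7.24): `(T̂⁽ᴷ⁾x)_{j+1} = Ǩ_{j+1}(μ_j, y_j, K_j)`. [cite: Slade2017, (7.24)] -/
theorem rowK_succ (x : Seq W) (j : ℕ) : rowK c d y₀ K₀ x (j + 1) =
    d.Kc j (μv c x j) (yv c y₀ x j) (Kv c K₀ x j) := rfl

/-- `K_0` is the given initial condition (`𝟙_∅` in the source). [cite: Slade2017, §7.2.1] -/
theorem Kv_zero (x : Seq W) : Kv c K₀ x 0 = K₀ := rfl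

/-- `K_{j+1} = 𝔴_K k_{j+1}`. [cite: Slade2017, (7.17)–(7.18)] -/
theorem Kv_succ (x : Seq W) (j : ℕ) : Kv c K₀ x (j + 1) = c.wK • (x (j + 1)).2.2 := rfl

/-- Rows of weight zero vanish (`(T̂x)_j = 0` if `j > j_m̃`, (7.22)). [cite: Slade2017, §7.2.2] -/
theorem Trow_eq_zero_of_w {x : Seq W} {j : ℕ} (hw : d.w j = 0) : Trow c d y₀ K₀ x j = 0 := by
  simp [Trow, hw]

namespace Hyp

variable (h : Hyp c d y₀ K₀)
include h

/-- On `B₁`: `‖K_j‖ ≤ λ_Ks̄³` ((7.26)). [cite: Slade2017, Theorem 7.2.2 (proof, first display)] -/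
theorem norm_Kv_le {x : Seq W} {j : ℕ} (hx : ‖x j‖ ≤ 1) : ‖Kv c K₀ x j‖ ≤ c.wK := by
  rcases j with _ | j
  · exact h.K₀_le
  · have h1 : ‖(x (j + 1)).2.2‖ ≤ 1 := (norm_thd_le_norm _).trans hx
    have := h.wK_pos
    rw [Kv_succ, norm_smul, Real.norm_eq_abs, abs_of_pos h.wK_pos]; nlinarith

/-- (7.9): the physical coordinates of a point of `B₁` lie in the RG domain.
[cite: Slade2017, (7.9)] -/
theorem inDom {x : Seq W} {j : ℕ} (hx : ‖x j‖ ≤ 1) :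
    InDom c (μv c x j) (yv c y₀ x j) (Kv c K₀ x j) :=
  ⟨h.abs_μv_le hx, h.abs_yv_le' hx, h.norm_Kv_le hx⟩

/-! ### Bound on `T` ((7.27)–(7.31)): `T : B₁ → B₁` -/

/-- (7.27): `|(T̂⁽μ⁾x)_j| ≤ L^{-α}σs̄² + Πs̄²(33/32)² + O(s̄³) ≤ σs̄²`. [cite: Slade2017, (7.27)] -/
theorem abs_rowμ_le {x : Seq W} (hx : ∀ j, ‖x j‖ ≤ 1) (j : ℕ) :
    |rowμ c d y₀ K₀ x j| ≤ c.wμ := by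
  have hμ1 := h.abs_μv_le (hx (j + 1))
  have hμ := h.abs_μv_le (hx j)
  have hy := h.abs_yv_le' (hx j)
  have hρ := h.abs_ρμ_le (j := j) hμ hy
  have hr := h.rμ_le j _ _ _ (h.inDom (hx j))
  have hLi := h.Lα_inv_le
  have hLi0 := h.Lα_inv_nonneg
  have hs := h.sbar_pos
  have hP := h.Pxi_pos
  have hB := h.Bβ_nn
  have hC := h.C₃_nn
  have hs1 := h.s₁
  rw [rowμ, abs_mul, abs_of_nonneg hLi0]
  have htri : |μv c x (j + 1) - ρμ c d j (μv c x j) (yv c y₀ x j) -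
      d.rμ j (μv c x j) (yv c y₀ x j) (Kv c K₀ x j)| ≤
      c.wμ + c.Lα * (c.Bβ * c.wμ * (33 / 32 * c.sbar) + c.Pxi * (33 / 32 * c.sbar) ^ 2)
        + c.C₃ * c.sbar ^ 3 :=
    (abs_sub _ _).trans (add_le_add ((abs_sub _ _).trans (add_le_add hμ1 hρ)) hr)
  calc c.Lα⁻¹ * |μv c x (j + 1) - ρμ c d j (μv c x j) (yv c y₀ x j) -
        d.rμ j (μv c x j) (yv c y₀ x j) (Kv c K₀ x j)|
      ≤ c.Lα⁻¹ * (c.wμ + c.Lα * (c.Bβ * c.wμ * (33 / 32 * c.sbar)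
          + c.Pxi * (33 / 32 * c.sbar) ^ 2) + c.C₃ * c.sbar ^ 3) :=
        mul_le_mul_of_nonneg_left htri hLi0
    _ = c.Lα⁻¹ * c.wμ + (c.Bβ * c.wμ * (33 / 32 * c.sbar) + c.Pxi * (33 / 32 * c.sbar) ^ 2)
          + c.Lα⁻¹ * (c.C₃ * c.sbar ^ 3) := by
        have : c.Lα⁻¹ * c.Lα = 1 := inv_mul_cancel₀ h.Lα_pos.ne'
        rw [mul_add, mul_add, ← mul_assoc, this, one_mul]
    _ ≤ 1 / 4 * c.wμ + (c.Bβ * c.wμ * (33 / 32 * c.sbar) + c.Pxi * (33 / 32 * c.sbar) ^ 2)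
          + 1 / 4 * (c.C₃ * c.sbar ^ 3) := by
        have := h.wμ_pos
        gcongr
    _ ≤ c.wμ := by
        simp only [Consts.wμ, Consts.σ]
        have key : (165 / 32 * c.Bβ * c.Pxi * c.sbar + c.C₃ * c.sbar / 4) * c.sbar ^ 2 ≤
            2 * c.Pxi * c.sbar ^ 2 := by
          refine mul_le_mul_of_nonneg_right ?_ (sq_nonneg _)
          have : 0 ≤ c.Bβ * c.Pxi * c.sbar := by positivity
          have : 0 ≤ c.C₃ * c.sbar := by positivity
          nlinarith
        have expand : 1 / 4 * (5 * c.Pxi * c.sbar ^ 2)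
            + (c.Bβ * (5 * c.Pxi * c.sbar ^ 2) * (33 / 32 * c.sbar)
              + c.Pxi * (33 / 32 * c.sbar) ^ 2) + 1 / 4 * (c.C₃ * c.sbar ^ 3)
            = (5 / 4 + 1089 / 1024) * (c.Pxi * c.sbar ^ 2)
              + (165 / 32 * c.Bβ * c.Pxi * c.sbar + c.C₃ * c.sbar / 4) * c.sbar ^ 2 := by ring
        rw [expand]
        nlinarith [mul_pos hP (pow_pos hs 2)]

/-- (7.29)–(7.31): `|(T̂⁽ʸ⁾x)_{j+1}| ≤ ω_{j+1} s̄`. [cite: Slade2017, (7.29)–(7.31)] -/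
theorem abs_rowy_succ_le {x : Seq W} (hx : ∀ j, ‖x j‖ ≤ 1) (j : ℕ) (hw : d.w (j + 1) ≠ 0) :
    |rowy c d y₀ K₀ x (j + 1)| ≤ c.wy (j + 1) := by
  have hy := h.abs_yv_le (hx j)
  have hY := h.abs_Ymap_le (j := j) hy
  have hr := h.ry_le j _ _ _ (h.inDom (hx j))
  have hx0 := h.x_pos; have hx1 := h.x_le; have hs := h.sbar_pos; have ha := h.a_pos
  have haxs := h.axs
  have hLε := c.Lε_eq
  have hs2 := h.s₂
  have hC := h.C₃_nn
  have has := h.as_le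
  have e2 : c.C₃ * c.sbar ^ 3 ≤ c.a / 100 * c.sbar ^ 2 := by nlinarith [sq_nonneg c.sbar]
  rw [rowy_succ]
  refine (abs_add_le _ _).trans ((add_le_add hY hr).trans ?_)
  rcases lt_or_ge j c.JL with hj | hj
  · -- lattice transients: `ω_j = ζ ω_{j+1}`, `|β^:_j - a| ≤ b_L`
    have hβ := h.βW_le₁ j hw hj
    have hω := c.omg_eq_of_lt hj
    have hω1 := h.omg_ge (j + 1)
    have hω1' := h.omg_le (j + 1)
    have hbL := h.bL_nn
    have hζ0 := h.ζ_ge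
    have hζ1 := h.ζ_le_one
    simp only [Consts.wy] at *
    rw [hω]
    set ω₁ := c.omg (j + 1) with hω₁
    set s := c.sbar with hs_def
    have hζ : c.ζ = 1 - 64 * c.bL * s := rfl
    have e1 : |d.βW j - c.a| * c.Lε * (33 / 32 * s) ^ 2 ≤ c.bL * (11 / 10) * (33 / 32 * s) ^ 2 :=
      mul_le_mul_of_nonneg_right (mul_le_mul hβ h.Lε_le h.Lε_pos.le hbL) (sq_nonneg _)
    -- the gain from `ζ`: `ζ ω₁ s = ω₁ s - 64 b_L s ω₁ s ≤ ω₁ s - 1.8 b_L s²`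
    have f2 : c.ζ * ω₁ * s = ω₁ * s - 64 * (c.bL * s) * ω₁ * s := by rw [hζ]; ring
    have f3 : 64 * (c.bL * s) * (9 / 320) * s ≤ 64 * (c.bL * s) * ω₁ * s := by
      have := h.u_nonneg
      apply mul_le_mul_of_nonneg_right _ hs.le
      exact mul_le_mul_of_nonneg_left hω1 (by positivity)
    -- the gain from `x`: `ζ ω₁ s · x(1 - ζ ω₁) ≥ 0.9 · (9/320) · (31/32) · a s²`
    have f1 : 9 / 10 * (9 / 320) * s * (c.a * s * (31 / 32)) ≤
        c.ζ * ω₁ * s * (c.xε * (1 - c.ζ * ω₁)) := by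
      have g1 : 9 / 10 * (9 / 320) ≤ c.ζ * ω₁ := mul_le_mul hζ0 hω1 (by norm_num) h.ζ_pos.le
      have g2 : c.ζ * ω₁ ≤ 1 / 32 := by nlinarith
      have g3 : c.a * s * (31 / 32) ≤ c.xε * (1 - c.ζ * ω₁) :=
        mul_le_mul has (by linarith) (by norm_num) hx0.le
      have g4 : 9 / 10 * (9 / 320) * s ≤ c.ζ * ω₁ * s := mul_le_mul_of_nonneg_right g1 hs.le
      exact mul_le_mul g4 g3 (by positivity) (by positivity)
    have eq : c.ζ * ω₁ * s * (1 - c.xε * (1 - c.ζ * ω₁)) =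
        c.ζ * ω₁ * s - c.ζ * ω₁ * s * (c.xε * (1 - c.ζ * ω₁)) := by ring
    nlinarith [f1, f2, f3, e1, e2, eq, mul_nonneg hbL (sq_nonneg s), mul_pos ha (pow_pos hs 2)]
  · -- bulk: `ω_j = ω_{j+1} = 1/32`, `|β^:_j - a| ≤ a/64`
    have hβ := h.βW_le₂ j hw hj
    have hω := c.omg_eq_of_le hj
    have hω' := c.omg_succ_eq_of_le hj
    simp only [Consts.wy] at *
    rw [hω, hω']
    rw [hω, hω'] at hY
    have e1 : |d.βW j - c.a| * c.Lε * (33 / 32 * c.sbar) ^ 2 ≤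
        c.a / 64 * c.Lε * (33 / 32 * c.sbar) ^ 2 :=
      mul_le_mul_of_nonneg_right (mul_le_mul_of_nonneg_right hβ h.Lε_pos.le) (sq_nonneg _)
    have e3 : c.xε * c.sbar = c.a * c.Lε * c.sbar ^ 2 := by rw [← haxs]; ring
    have e4 : c.a * c.sbar ^ 2 ≤ c.a * c.Lε * c.sbar ^ 2 := by
      have := h.one_le_Lε; nlinarith [mul_pos ha (pow_pos hs 2)]
    have eq : 1 / 32 * c.sbar * (1 - c.xε * (1 - 1 / 32)) =
        1 / 32 * c.sbar - 31 / 1024 * (c.xε * c.sbar) := by ring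
    nlinarith [e1, e2, e3, e4, eq, mul_pos ha (pow_pos hs 2)]

/-- (7.28): `‖(T̂⁽ᴷ⁾x)_j‖ ≤ λ_K s̄³`. [cite: Slade2017, (7.28)] -/
theorem norm_rowK_le {x : Seq W} (hx : ∀ j, ‖x j‖ ≤ 1) (j : ℕ) :
    ‖rowK c d y₀ K₀ x j‖ ≤ c.wK := by
  rcases j with _ | j
  · rw [rowK_zero, norm_zero]; exact h.wK_pos.le
  · rw [rowK_succ]; exact h.Kc_le j _ _ _ (h.inDom (hx j))

/-- **Theorem 7.2.2, first half: `T : B₁ → B₁`** (for every truncation).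
[cite: Slade2017, Theorem 7.2.2 (bound on T)] -/
theorem norm_trow_le {x : Seq W} (hx : ∀ j, ‖x j‖ ≤ 1) (j : ℕ) :
    ‖Trow c d y₀ K₀ x j‖ ≤ 1 := by
  have hw0 := h.w_nn j; have hw1 := h.w_le j
  refine norm_triple_le ?_ ?_ ?_
  · -- μ
    simp only [Trow]
    rw [abs_div, abs_mul, abs_of_nonneg hw0, abs_of_pos h.wμ_pos, div_le_one h.wμ_pos]
    calc d.w j * |rowμ c d y₀ K₀ x j| ≤ 1 * c.wμ :=
          mul_le_mul hw1 (h.abs_rowμ_le hx j) (abs_nonneg _) zero_le_one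
      _ = c.wμ := one_mul _
  · -- y
    simp only [Trow]
    rw [abs_div, abs_mul, abs_of_nonneg hw0, abs_of_pos (h.wy_pos j), div_le_one (h.wy_pos j)]
    rcases j with _ | j
    · rw [rowy_zero, abs_zero, mul_zero]; exact (h.wy_pos 0).le
    · by_cases hw : d.w (j + 1) = 0
      · rw [hw, zero_mul]; exact (h.wy_pos _).le
      · calc d.w (j + 1) * |rowy c d y₀ K₀ x (j + 1)| ≤ 1 * c.wy (j + 1) :=
              mul_le_mul hw1 (h.abs_rowy_succ_le hx j hw) (abs_nonneg _) zero_le_one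
          _ = _ := one_mul _
  · -- K
    simp only [Trow]
    rw [norm_smul, Real.norm_eq_abs, abs_div, abs_of_nonneg hw0, abs_of_pos h.wK_pos]
    calc d.w j / c.wK * ‖rowK c d y₀ K₀ x j‖ ≤ 1 / c.wK * c.wK := by
          have := h.wK_pos
          exact mul_le_mul (div_le_div_of_nonneg_right hw1 this.le) (h.norm_rowK_le hx j)
            (norm_nonneg _) (by positivity)
      _ = 1 := by field_simp [h.wK_pos.ne']



/-! ### Bound on `DT` ((7.32)–(7.44)): `T` is a contraction on `B₁` (Lipschitz form) -/

/-- `‖K_j - K'_j‖ ≤ 𝔴_K ‖x - x'‖` (zero at `j = 0`). [cite: Slade2017, (7.17)–(7.18)] -/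
theorem norm_Kv_sub_le {x x' : Seq W} {D : ℝ} (hD : ∀ j, dist (x j) (x' j) ≤ D) (j : ℕ) :
    ‖Kv c K₀ x j - Kv c K₀ x' j‖ ≤ c.wK * D := by
  have hD0 : 0 ≤ D := dist_nonneg.trans (hD 0)
  rcases j with _ | j
  · rw [Kv_zero, Kv_zero, sub_self, norm_zero]
    exact mul_nonneg h.wK_pos.le hD0
  · have h1 := (norm_thd_sub_le (x (j + 1)) (x' (j + 1))).trans (hD (j + 1))
    rw [Kv_succ, Kv_succ, ← smul_sub, norm_smul, Real.norm_eq_abs, abs_of_pos h.wK_pos]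
    exact mul_le_mul_of_nonneg_left h1 h.wK_pos.le

section Lip

variable {x x' : Seq W} {D : ℝ} (hx : ∀ j, ‖x j‖ ≤ 1) (hx' : ∀ j, ‖x' j‖ ≤ 1)
  (hD : ∀ j, dist (x j) (x' j) ≤ D)
include hx hx' hD

/-- (7.32)–(7.34): the `μ`-row is `½`-Lipschitz (`L^{-α} + O(s̄) + ω(⅘ + O(s̄)) ≤ ½`).
[cite: Slade2017, (7.32)–(7.34)] -/
theorem abs_rowμ_sub_le (j : ℕ) :
    |rowμ c d y₀ K₀ x j - rowμ c d y₀ K₀ x' j| ≤ 1 / 2 * c.wμ * D := by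
  have hD0 : 0 ≤ D := dist_nonneg.trans (hD 0)
  have hdμ1 := h.abs_μv_sub_le hD (j + 1)
  have hdm := h.abs_μv_sub_le hD j
  have hdy := h.abs_yv_sub_le' hD j
  have hdK := h.norm_Kv_sub_le hD j
  have hρ := h.abs_ρμ_sub_le hx hx' hD j
  have hr := h.rμ_lip j _ _ _ _ _ _ (h.inDom (hx j)) (h.inDom (hx' j))
  have hLi := h.Lα_inv_le
  have hLi0 := h.Lα_inv_nonneg
  have hs := h.sbar_pos; have hs1 := h.sbar_le
  have hP := h.Pxi_pos; have hB := h.Bβ_nn; have hC2 := h.C₂_nn; have hC0 := h.C₀_nn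
  have hlam := h.lamK_pos
  have hs3 := h.s₃; have hs4 := h.s₄
  have hfac : rowμ c d y₀ K₀ x j - rowμ c d y₀ K₀ x' j =
      c.Lα⁻¹ * ((μv c x (j + 1) - μv c x' (j + 1))
        - (ρμ c d j (μv c x j) (yv c y₀ x j) - ρμ c d j (μv c x' j) (yv c y₀ x' j))
        - (d.rμ j (μv c x j) (yv c y₀ x j) (Kv c K₀ x j)
          - d.rμ j (μv c x' j) (yv c y₀ x' j) (Kv c K₀ x' j))) := by
    simp only [rowμ]; ring
  rw [hfac, abs_mul, abs_of_nonneg hLi0]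
  have hC2s : 0 ≤ c.C₂ * c.sbar ^ 2 := by positivity
  have htri := (abs_sub _ _).trans (add_le_add ((abs_sub _ _).trans (add_le_add hdμ1 hρ))
    (hr.trans (add_le_add (mul_le_mul_of_nonneg_left (add_le_add hdm hdy) hC2s)
      (mul_le_mul_of_nonneg_left hdK hC0))))
  refine (mul_le_mul_of_nonneg_left htri hLi0).trans ?_
  have hLL : c.Lα⁻¹ * c.Lα = 1 := inv_mul_cancel₀ h.Lα_pos.ne'
  -- `L^{-α}(A + L^α B + C) = L^{-α}A + B + L^{-α}C ≤ A/4 + B + C/4`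
  set A := c.wμ * D with hA
  set B := c.Bβ * (33 / 32 * c.sbar * (c.wμ * D) + c.wμ * (c.sbar / 32 * D))
    + c.Pxi * (33 / 16 * c.sbar) * (c.sbar / 32 * D) with hB_def
  set C := c.C₂ * c.sbar ^ 2 * (c.wμ * D + c.sbar / 32 * D) + c.C₀ * (c.wK * D) with hC_def
  have hA0 : 0 ≤ A := by rw [hA]; exact mul_nonneg h.wμ_pos.le hD0
  have hC0' : 0 ≤ C := by rw [hC_def]; have := h.wμ_pos; have := h.wK_pos; positivity
  have step : c.Lα⁻¹ * (A + c.Lα * B + C) ≤ 1 / 4 * A + B + 1 / 4 * C := by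
    have e : c.Lα⁻¹ * (A + c.Lα * B + C) = c.Lα⁻¹ * A + B + c.Lα⁻¹ * C := by
      rw [mul_add, mul_add, ← mul_assoc c.Lα⁻¹ c.Lα B, hLL, one_mul]
    rw [e]
    have := mul_le_mul_of_nonneg_right hLi hA0
    have := mul_le_mul_of_nonneg_right hLi hC0'
    linarith
  refine step.trans ?_
  simp only [hA, hB_def, hC_def, Consts.wμ, Consts.σ, Consts.wK]
  have e : 1 / 4 * (5 * c.Pxi * c.sbar ^ 2 * D)
      + (c.Bβ * (33 / 32 * c.sbar * (5 * c.Pxi * c.sbar ^ 2 * D)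
        + 5 * c.Pxi * c.sbar ^ 2 * (c.sbar / 32 * D))
        + c.Pxi * (33 / 16 * c.sbar) * (c.sbar / 32 * D))
      + 1 / 4 * (c.C₂ * c.sbar ^ 2 * (5 * c.Pxi * c.sbar ^ 2 * D + c.sbar / 32 * D)
        + c.C₀ * (c.lamK * c.sbar ^ 3 * D))
      = c.sbar ^ 2 * D * (5 / 4 * c.Pxi + 33 / 512 * c.Pxi + 170 / 32 * (c.Pxi * (c.Bβ * c.sbar))
        + 5 / 4 * (c.Pxi * (c.C₂ * c.sbar * c.sbar))
        + 1 / 4 * (c.C₂ * c.sbar / 32 + c.lamK * c.C₀ * c.sbar)) := by ring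
  have goal_eq : 1 / 2 * (5 * c.Pxi * c.sbar ^ 2) * D = c.sbar ^ 2 * D * (5 / 2 * c.Pxi) := by ring
  rw [e, goal_eq]
  refine mul_le_mul_of_nonneg_left ?_ (by positivity)
  have hs3' : 2 * c.Bβ * c.sbar + c.C₂ * c.sbar ≤ 1 / 10 := by
    have e' : 2 * c.Bβ * c.sbar + c.C₂ * c.sbar = (2 * c.Bβ + c.C₂) * c.sbar := by ring
    rw [e']; exact hs3
  have hs4' : c.C₂ * c.sbar + c.lamK * c.C₀ * c.sbar ≤ c.Pxi / 10 := by
    have e' : c.C₂ * c.sbar + c.lamK * c.C₀ * c.sbar = (c.C₂ + c.lamK * c.C₀) * c.sbar := by ring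
    rw [e']; exact hs4
  have hC2s' : 0 ≤ c.C₂ * c.sbar := by positivity
  have hBs0 : 0 ≤ c.Bβ * c.sbar := by positivity
  have hBs : c.Bβ * c.sbar ≤ 1 / 20 := by linarith
  have hCs : c.C₂ * c.sbar * c.sbar ≤ 1 / 10 := by
    have : c.C₂ * c.sbar * c.sbar ≤ c.C₂ * c.sbar * 1 := mul_le_mul_of_nonneg_left hs1 hC2s'
    linarith
  have f1 := mul_le_mul_of_nonneg_left hBs hP.le
  have f2 := mul_le_mul_of_nonneg_left hCs hP.le
  linarith

/-- (7.37)–(7.44): the `y`-row is `(1 - x/4)`-Lipschitz. [cite: Slade2017, (7.37)–(7.44)] -/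
theorem abs_rowy_succ_sub_le (j : ℕ) (hw : d.w (j + 1) ≠ 0) :
    |rowy c d y₀ K₀ x (j + 1) - rowy c d y₀ K₀ x' (j + 1)| ≤ c.cLip * c.wy (j + 1) * D := by
  have hD0 : 0 ≤ D := dist_nonneg.trans (hD 0)
  have hy := h.abs_yv_le (hx j)
  have hy' := h.abs_yv_le (hx' j)
  have hdm := h.abs_μv_sub_le hD j
  have hdy := h.abs_yv_sub_le hD j
  have hdy' := h.abs_yv_sub_le' hD j
  have hdK := h.norm_Kv_sub_le hD j
  have hY := h.abs_Ymap_sub_le (j := j) hy hy'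
  have hr := h.ry_lip j _ _ _ _ _ _ (h.inDom (hx j)) (h.inDom (hx' j))
  have cross := h.cross_le hD
  have hs := h.sbar_pos; have ha := h.a_pos
  have hx0 := h.x_pos; have hx1 := h.x_le
  have hC2 := h.C₂_nn; have hC0 := h.C₀_nn
  have haxs := h.axs
  have hLε := h.Lε_pos; have hLε' := h.Lε_le
  rw [rowy_succ, rowy_succ]
  have hfac : Ymap c d j (yv c y₀ x j) + d.ry j (μv c x j) (yv c y₀ x j) (Kv c K₀ x j)
      - (Ymap c d j (yv c y₀ x' j) + d.ry j (μv c x' j) (yv c y₀ x' j) (Kv c K₀ x' j))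
      = (Ymap c d j (yv c y₀ x j) - Ymap c d j (yv c y₀ x' j))
        + (d.ry j (μv c x j) (yv c y₀ x j) (Kv c K₀ x j)
          - d.ry j (μv c x' j) (yv c y₀ x' j) (Kv c K₀ x' j)) := by ring
  rw [hfac]
  have hT0 : 0 ≤ 2 * |d.βW j - c.a| * c.Lε * (33 / 32 * c.sbar) := by positivity
  have hBr0 : 0 ≤ 1 - c.xε + 2 * c.xε * c.omg j
      + 2 * |d.βW j - c.a| * c.Lε * (33 / 32 * c.sbar) := by
    have := h.omg_pos j; nlinarith
  have hC2s : 0 ≤ c.C₂ * c.sbar ^ 2 := by positivity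
  have htri := (abs_add_le _ _).trans (add_le_add
    (hY.trans (mul_le_mul_of_nonneg_left hdy hBr0))
    (hr.trans (add_le_add (mul_le_mul_of_nonneg_left (add_le_add hdm hdy') hC2s)
      (mul_le_mul_of_nonneg_left hdK hC0))))
  refine htri.trans ?_
  refine (add_le_add le_rfl cross).trans ?_
  rcases lt_or_ge j c.JL with hj | hj
  · have hβ := h.βW_le₁ j hw hj
    have hω := c.omg_eq_of_lt hj
    have hω1 := h.omg_ge (j + 1); have hω1' := h.omg_le (j + 1)
    have hζ0 := h.ζ_ge; have hζ1 := h.ζ_le_one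
    have hbL := h.bL_nn; have hu := h.u_le; have hu0 := h.u_nonneg
    simp only [Consts.wy, Consts.cLip]
    rw [hω]
    set ω₁ := c.omg (j + 1) with hω₁
    set u := c.bL * c.sbar with hu_def
    have hζ : c.ζ = 1 - 64 * u := by rw [hu_def]; simp only [Consts.ζ]; ring
    -- `T ≤ (5/2) u`
    have hT : 2 * |d.βW j - c.a| * c.Lε * (33 / 32 * c.sbar) ≤ 5 / 2 * u := by
      have t : |d.βW j - c.a| * c.Lε ≤ c.bL * (11 / 10) := mul_le_mul hβ hLε' hLε.le hbL
      have eT : 2 * |d.βW j - c.a| * c.Lε * (33 / 32 * c.sbar) =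
          (33 / 16 * c.sbar) * (|d.βW j - c.a| * c.Lε) := by ring
      rw [eT]
      have := mul_le_mul_of_nonneg_left t (show 0 ≤ 33 / 16 * c.sbar by positivity)
      have e2 : 33 / 16 * c.sbar * (c.bL * (11 / 10)) = 363 / 160 * u := by rw [hu_def]; ring
      have hu0' : 0 ≤ u := hu0
      linarith
    have hω10 : 0 ≤ ω₁ := (h.omg_pos (j + 1)).le
    have hζω : c.ζ * ω₁ ≤ 1 / 32 := by
      have := mul_le_mul hζ1 hω1' hω10 zero_le_one; linarith
    have hζω0 : 0 ≤ c.ζ * ω₁ := mul_nonneg h.ζ_pos.le hω10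
    -- the bracket `Br`
    set Br := 1 - c.xε + 2 * c.xε * (c.ζ * ω₁) + 2 * |d.βW j - c.a| * c.Lε * (33 / 32 * c.sbar)
      with hBr
    have h2x : 2 * c.xε * (c.ζ * ω₁) ≤ 2 * c.xε * (1 / 32) :=
      mul_le_mul_of_nonneg_left hζω (by linarith)
    have h2x0 : 0 ≤ 2 * c.xε * (c.ζ * ω₁) := mul_nonneg (by linarith) hζω0
    have hBle : Br ≤ 1 - 15 / 16 * c.xε + 5 / 2 * u := by rw [hBr]; linarith
    have hBge : 9 / 10 ≤ Br := by rw [hBr]; linarith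
    have hζBr : c.ζ * Br ≤ 1 - 3 / 5 * c.xε := by
      rw [hζ]
      have p := mul_le_mul_of_nonneg_left hBge hu0
      have e3 : (1 - 64 * u) * Br = Br - 64 * (u * Br) := by ring
      rw [e3]
      have hu0' : 0 ≤ u := hu0
      linarith
    have hM0 : 0 ≤ ω₁ * c.sbar * D := by positivity
    have hsDx : 0 ≤ c.sbar * D * c.xε := by positivity
    have q := mul_le_mul_of_nonneg_right hω1 hsDx
    have eq1 : Br * (c.ζ * ω₁ * c.sbar * D) = (c.ζ * Br) * (ω₁ * c.sbar * D) := by ring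
    rw [eq1]
    have r := mul_le_mul_of_nonneg_right hζBr hM0
    linarith
  · have hβ := h.βW_le₂ j hw hj
    have hω := c.omg_eq_of_le hj
    have hω' := c.omg_succ_eq_of_le hj
    simp only [Consts.wy, Consts.cLip]
    rw [hω, hω']
    have hT : 2 * |d.βW j - c.a| * c.Lε * (33 / 32 * c.sbar) ≤ 33 / 1024 * c.xε := by
      have e : 2 * (c.a / 64) * c.Lε * (33 / 32 * c.sbar) = 33 / 1024 * (c.a * c.Lε * c.sbar) := by
        ring
      calc 2 * |d.βW j - c.a| * c.Lε * (33 / 32 * c.sbar)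
          ≤ 2 * (c.a / 64) * c.Lε * (33 / 32 * c.sbar) := by gcongr
        _ = 33 / 1024 * c.xε := by rw [e, haxs]
    have hsD : 0 ≤ c.sbar * D := by positivity
    have eq1 : (1 - c.xε + 2 * c.xε * (1 / 32) + 2 * |d.βW j - c.a| * c.Lε * (33 / 32 * c.sbar))
        * (1 / 32 * c.sbar * D) + 9 / 320 * c.sbar * D * (7 / 20 * c.xε)
        = (c.sbar * D) * (1 / 32 * (1 - c.xε + 2 * c.xε * (1 / 32)
          + 2 * |d.βW j - c.a| * c.Lε * (33 / 32 * c.sbar)) + 63 / 6400 * c.xε) := by ring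
    have goal_eq : (1 - c.xε / 4) * (1 / 32 * c.sbar) * D
        = (c.sbar * D) * (1 / 32 * (1 - c.xε / 4)) := by
      ring
    rw [eq1, goal_eq]
    refine mul_le_mul_of_nonneg_left ?_ hsD
    linarith

/-- (7.35)–(7.36): the `K`-row is `¾`-Lipschitz. [cite: Slade2017, (7.35)–(7.36)] -/
theorem norm_rowK_sub_le (j : ℕ) :
    ‖rowK c d y₀ K₀ x j - rowK c d y₀ K₀ x' j‖ ≤ 3 / 4 * c.wK * D := by
  have hD0 : 0 ≤ D := dist_nonneg.trans (hD 0)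
  rcases j with _ | j
  · simp only [rowK_zero, sub_self, norm_zero]; have := h.wK_pos; positivity
  have hdm := h.abs_μv_sub_le hD j
  have hdy := h.abs_yv_sub_le' hD j
  have hdK := h.norm_Kv_sub_le hD j
  have hK := h.Kc_lip j _ _ _ _ _ _ (h.inDom (hx j)) (h.inDom (hx' j))
  have hs := h.sbar_pos; have hs1 := h.sbar_le
  have hP := h.Pxi_pos; have hCK := h.CK_nn; have hCK' := h.CK_le
  have hκ := h.κ_nn; have hκ' := h.κ_le; have hlam := h.lamK_pos; have hs7 := h.s₇
  rw [rowK_succ, rowK_succ]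
  have hCKs : 0 ≤ c.CK * c.sbar ^ 2 := by positivity
  refine (hK.trans (add_le_add (mul_le_mul_of_nonneg_left (add_le_add hdm hdy) hCKs)
    (mul_le_mul_of_nonneg_left hdK hκ))).trans ?_
  simp only [Consts.wμ, Consts.σ, Consts.wK]
  have e : c.CK * c.sbar ^ 2 * (5 * c.Pxi * c.sbar ^ 2 * D + c.sbar / 32 * D)
      + c.κ * (c.lamK * c.sbar ^ 3 * D)
      = c.sbar ^ 3 * D * ((5 * c.Pxi * c.CK * c.sbar) + c.CK / 32 + c.κ * c.lamK) := by ring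
  have goal_eq : 3 / 4 * (c.lamK * c.sbar ^ 3) * D = c.sbar ^ 3 * D * (3 / 4 * c.lamK) := by ring
  rw [e, goal_eq]
  refine mul_le_mul_of_nonneg_left ?_ (by positivity)
  have := mul_le_mul_of_nonneg_right hκ' hlam.le
  linarith

/-- **Theorem 7.2.2, second half: `T` is a contraction on `B₁`**, with Lipschitz constant
`1 - x/4 < 1` (`x = L^ε - 1 ∼ ε log L`; the printed bound is `‖DT‖ ≤ 1 - ¾ε log L`).
[cite: Slade2017, Theorem 7.2.2 (bound on DT)] -/
theorem dist_trow_le (j : ℕ) :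
    dist (Trow c d y₀ K₀ x j) (Trow c d y₀ K₀ x' j) ≤ c.cLip * D := by
  have hD0 : 0 ≤ D := dist_nonneg.trans (hD 0)
  have hw0 := h.w_nn j; have hw1 := h.w_le j
  have hcL := h.cLip_nonneg
  have hc34 : 3 / 4 ≤ c.cLip := by have := h.x_le; simp only [Consts.cLip]; linarith
  rw [Prod.dist_eq, Prod.dist_eq]
  refine max_le ?_ (max_le ?_ ?_)
  · -- μ
    simp only [Trow]
    rw [Real.dist_eq, ← sub_div, ← mul_sub, abs_div, abs_mul, abs_of_nonneg hw0,
      abs_of_pos h.wμ_pos, div_le_iff₀ h.wμ_pos]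
    calc d.w j * |rowμ c d y₀ K₀ x j - rowμ c d y₀ K₀ x' j| ≤ 1 * (1 / 2 * c.wμ * D) :=
          mul_le_mul hw1 (h.abs_rowμ_sub_le hx hx' hD j) (abs_nonneg _) zero_le_one
      _ ≤ c.cLip * D * c.wμ := by nlinarith [mul_nonneg h.wμ_pos.le hD0]
  · -- y
    simp only [Trow]
    rw [Real.dist_eq, ← sub_div, ← mul_sub, abs_div, abs_mul, abs_of_nonneg hw0,
      abs_of_pos (h.wy_pos j), div_le_iff₀ (h.wy_pos j)]
    rcases j with _ | j
    · simp only [rowy_zero, sub_self, abs_zero, mul_zero]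
      have := h.wy_pos 0; positivity
    · by_cases hw : d.w (j + 1) = 0
      · rw [hw, zero_mul]; have := h.wy_pos (j + 1); positivity
      · calc d.w (j + 1) * |rowy c d y₀ K₀ x (j + 1) - rowy c d y₀ K₀ x' (j + 1)|
            ≤ 1 * (c.cLip * c.wy (j + 1) * D) :=
              mul_le_mul hw1 (h.abs_rowy_succ_sub_le hx hx' hD j hw) (abs_nonneg _) zero_le_one
          _ = c.cLip * D * c.wy (j + 1) := by ring
  · -- K
    simp only [Trow]
    rw [dist_eq_norm, ← smul_sub, norm_smul, Real.norm_eq_abs, abs_div, abs_of_nonneg hw0,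
      abs_of_pos h.wK_pos]
    calc d.w j / c.wK * ‖rowK c d y₀ K₀ x j - rowK c d y₀ K₀ x' j‖
        ≤ 1 / c.wK * (3 / 4 * c.wK * D) := by
          have := h.wK_pos
          exact mul_le_mul (div_le_div_of_nonneg_right hw1 this.le)
            (h.norm_rowK_sub_le hx hx' hD j) (norm_nonneg _) (by positivity)
      _ = 3 / 4 * D := by field_simp [h.wK_pos.ne']
      _ ≤ c.cLip * D := mul_le_mul_of_nonneg_right hc34 hD0

end Lip

end Hyp

end Rows

section FixedPoint

variable {W : ℕ → Type*} [∀ j, NormedAddCommGroup (W j)] [∀ j, NormedSpace ℝ (W j)]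

/-- The Banach space `X = ⊕_j X_j` of §7.2.1 in rescaled coordinates: `ℓ^∞(j ↦ ℝ × ℝ × 𝒲_j)`,
whose closed unit ball is `B₁(X)` of (7.17)–(7.18). [cite: Slade2017, §7.2.1] -/
abbrev X (W : ℕ → Type*) [∀ j, NormedAddCommGroup (W j)] := lp (fun j => ℝ × ℝ × W j) ∞

variable {c : Consts} {d : Data W} {y₀ : ℝ} {K₀ : W 0}

/-- **Slade, Theorem 7.2.2** (inputs explicit): `T : B₁ → B₁` and `T` is a contraction of
`B₁(X)` with ratio `1 - x/4 < 1` (the printed proof bounds `‖DT‖`; the Lipschitz form is what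
the contraction mapping principle uses). [cite: Slade2017, Theorem 7.2.2] -/
theorem Slade2017_thm722 (h : Hyp c d y₀ K₀) :
    (∀ x : X W, (∀ j, ‖x j‖ ≤ 1) → ∀ j, ‖Trow c d y₀ K₀ x j‖ ≤ 1) ∧
    (∀ x x' : X W, (∀ j, ‖x j‖ ≤ 1) → (∀ j, ‖x' j‖ ≤ 1) →
      ∀ j, dist (Trow c d y₀ K₀ x j) (Trow c d y₀ K₀ x' j) ≤ c.cLip * dist x x') ∧
    c.cLip < 1 :=
  ⟨fun _ hx j => h.norm_trow_le hx j,
    fun x x' hx hx' j => h.dist_trow_le hx hx' (fun j => FlowSpace.dist_apply_le x x' j) j,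
    h.cLip_lt_one⟩

/-- **The fixed point `x^c` of `T` in `B₁`** (§7.2.4, first paragraph: "Together with the
contraction mapping principle, Theorem 7.2.2 implies that `T` has a unique fixed point
`x^c ∈ B₁`"). [cite: Slade2017, §7.2.4] -/
theorem exists_fixedPoint [∀ j, CompleteSpace (W j)] (h : Hyp c d y₀ K₀) :
    ∃ xs : X W, (∀ j, ‖xs j‖ ≤ 1) ∧ ⇑xs = Trow c d y₀ K₀ xs ∧
      ∀ y : X W, (∀ j, ‖y j‖ ≤ 1) → ⇑y = Trow c d y₀ K₀ y → y = xs := by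
  obtain ⟨hb, hl, hc⟩ := Slade2017_thm722 h
  have hc' : Real.toNNReal c.cLip < 1 := Real.toNNReal_lt_one.2 hc
  refine FlowSpace.exists_fixedPoint' hc' hb fun x x' hx hx' j => ?_
  rw [Real.coe_toNNReal _ h.cLip_nonneg]; exact hl x x' hx hx' j

/-- **The flow defined by the fixed point** (§7.2.2: "a fixed point of `T̂` … defines a flow
satisfying (7.13)–(7.15) up to scale `j_m̃`, with initial condition given by `(y_0, 𝟙_∅)`"):
at a fixed point `x = Tx` in `B₁`, the physical coordinates stay in the RG domain at every
scale (`|μ_j| ≤ σs̄²`, `|y_j| ≤ ω_js̄`, `‖K_j‖ ≤ λ_Ks̄³`, (7.9)), and at the scales of weight one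
they solve the flow equations of Lemma 7.1.1: `μ_{j+1} = L^αμ_j + ρ_{μ,j} + r_{μ,j}`,
`y_{j+1} = c_εy_j + aL^εy_j² + (β^:_j - a)L^ε(s̄ - y_j)² + r_{y,j}`,
`K_{j+1} = Ǩ_{j+1}(μ_j,y_j,K_j)`; where the weight vanishes, `μ_j = 0` (the final condition).
[cite: Slade2017, Lemma 7.1.1, §7.2.2, §7.2.4] -/
theorem flow_of_fixedPoint (h : Hyp c d y₀ K₀) {x : Seq W} (hx : ∀ j, ‖x j‖ ≤ 1)
    (hfix : x = Trow c d y₀ K₀ x) :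
    (∀ j, |μv c x j| ≤ c.wμ ∧ |yv c y₀ x j| ≤ c.wy j ∧ ‖Kv c K₀ x j‖ ≤ c.wK) ∧
    (∀ j, d.w j = 1 → μv c x (j + 1) = c.Lα * μv c x j + ρμ c d j (μv c x j) (yv c y₀ x j)
        + d.rμ j (μv c x j) (yv c y₀ x j) (Kv c K₀ x j)) ∧
    (∀ j, d.w (j + 1) = 1 → yv c y₀ x (j + 1) = Ymap c d j (yv c y₀ x j)
        + d.ry j (μv c x j) (yv c y₀ x j) (Kv c K₀ x j)) ∧
    (∀ j, d.w (j + 1) = 1 → Kv c K₀ x (j + 1) = d.Kc j (μv c x j) (yv c y₀ x j) (Kv c K₀ x j)) ∧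
    (∀ j, d.w j = 0 → μv c x j = 0) := by
  refine ⟨fun j => ⟨h.abs_μv_le (hx j), h.abs_yv_le (hx j), h.norm_Kv_le (hx j)⟩,
    fun j hw => ?_, fun j hw => ?_, fun j hw => ?_, fun j hw => ?_⟩
  · have e : (x j).1 = d.w j * rowμ c d y₀ K₀ x j / c.wμ :=
      congrArg (fun v => v.1) (congrFun hfix j)
    have hμ : μv c x j = rowμ c d y₀ K₀ x j := by
      rw [μv, e, hw, one_mul, mul_div_cancel₀ _ h.wμ_pos.ne']
    have h2 : c.Lα * μv c x j = μv c x (j + 1) - ρμ c d j (μv c x j) (yv c y₀ x j)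
        - d.rμ j (μv c x j) (yv c y₀ x j) (Kv c K₀ x j) := by
      conv_lhs => rw [hμ, rowμ, ← mul_assoc, mul_inv_cancel₀ h.Lα_pos.ne', one_mul]
    linarith
  · have e : (x (j + 1)).2.1 = d.w (j + 1) * rowy c d y₀ K₀ x (j + 1) / c.wy (j + 1) :=
      congrArg (fun v => v.2.1) (congrFun hfix (j + 1))
    rw [yv_succ, e, hw, one_mul, mul_div_cancel₀ _ (h.wy_pos _).ne', rowy_succ]
  · have e : (x (j + 1)).2.2 = (d.w (j + 1) / c.wK) • rowK c d y₀ K₀ x (j + 1) :=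
      congrArg (fun v => v.2.2) (congrFun hfix (j + 1))
    rw [Kv_succ, e, hw, smul_smul, one_div, mul_inv_cancel₀ h.wK_pos.ne', one_smul, rowK_succ]
  · have e : (x j).1 = d.w j * rowμ c d y₀ K₀ x j / c.wμ :=
      congrArg (fun v => v.1) (congrFun hfix j)
    rw [μv, e, hw, zero_mul, zero_div, mul_zero]

/-- **Slade, Lemma 7.2.1** (inputs explicit): for `x ∈ B₁`, `p ↦ T_p x` is continuous into
`X` on a parameter set `S`, provided the data depend continuously on `p` pointwise (the
coefficients `β_j, β^:_j, ξ̃_j` by Lemma 5.2.1, the remainders and `Ǩ` by the mass continuity of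
Theorem 6.3.1), the truncation weights `w_j(p)` are continuous (the `(1 - δ_m̃)` smoothing of
(7.25)–(7.27)), and locally only finitely many weights are non-zero (`(Tx)_j = 0` for
`j > j_m̃ + 1`). [cite: Slade2017, Lemma 7.2.1] -/
theorem Slade2017_lem721 {P : Type*} [TopologicalSpace P] {S : Set P} {d : P → Data W}
    (h : ∀ p ∈ S, Hyp c (d p) y₀ K₀)
    (hβ : ∀ j, ContinuousOn (fun p => (d p).β j) S)
    (hβW : ∀ j, ContinuousOn (fun p => (d p).βW j) S)
    (hξ : ∀ j, ContinuousOn (fun p => (d p).ξ j) S)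
    (hrμ : ∀ j m y (K : W j), ContinuousOn (fun p => (d p).rμ j m y K) S)
    (hry : ∀ j m y (K : W j), ContinuousOn (fun p => (d p).ry j m y K) S)
    (hKc : ∀ j m y (K : W j), ContinuousOn (fun p => (d p).Kc j m y K) S)
    (hw : ∀ j, ContinuousOn (fun p => (d p).w j) S)
    (hsupp : ∀ p₀ ∈ S, ∃ U ∈ 𝓝[S] p₀, ∃ J : ℕ, ∀ p ∈ U, ∀ j, J ≤ j → (d p).w j = 0)
    (x : X W) (hx : ∀ j, ‖x j‖ ≤ 1) :
    ContinuousOn (fun p => FlowSpace.liftOp (Trow c (d p) y₀ K₀) x) S := by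
  refine FlowSpace.liftOp_continuousOn (C := 1) (fun p hp j => (h p hp).norm_trow_le hx j)
    (fun j => ?_) (fun p₀ hp₀ => ?_)
  · -- coordinatewise continuity
    have hρ : ∀ j, ContinuousOn (fun p => ρμ c (d p) j (μv c x j) (yv c y₀ x j)) S := fun j => by
      simp only [ρμ]
      exact continuousOn_const.mul (((((continuousOn_const.mul (hβ j)).mul continuousOn_const).mul
        continuousOn_const)).add ((hξ j).mul continuousOn_const))
    have hrowμ : ContinuousOn (fun p => rowμ c (d p) y₀ K₀ x j) S := by
      simp only [rowμ]
      exact continuousOn_const.mul ((continuousOn_const.sub (hρ j)).sub (hrμ j _ _ _))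
    have hrowy : ContinuousOn (fun p => rowy c (d p) y₀ K₀ x j) S := by
      rcases j with _ | j
      · exact continuousOn_const
      · simp only [rowy_succ, Ymap]
        exact ((continuousOn_const.add continuousOn_const).add
          ((((hβW j).sub continuousOn_const).mul continuousOn_const).mul continuousOn_const)).add
          (hry j _ _ _)
    have hrowK : ContinuousOn (fun p => rowK c (d p) y₀ K₀ x j) S := by
      rcases j with _ | j
      · exact continuousOn_const
      · simp only [rowK_succ]; exact hKc j _ _ _
    simp only [Trow]
    exact (((hw j).mul hrowμ).div_const _).prodMk
      ((((hw j).mul hrowy).div_const _).prodMk (((hw j).div_const _).smul hrowK))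
  · obtain ⟨U, hU, J, hJ⟩ := hsupp p₀ hp₀
    exact ⟨U, hU, J, fun p hp j hj => Trow_eq_zero_of_w (hJ p hp j hj)⟩

/-- **Slade, Corollary 7.2.4** (inputs explicit): the fixed point `x^c(p)` of `T_p` in `B₁`, and
in particular the critical initial value `μ_0(p) = (x^c_0)^{(μ)}(p)`, depends continuously on
the parameter `p ∈ S` (in the source `p = (m̃², m²) ∈ 𝕄`), by "the version of the contraction
mapping principle given in [LS14]" (`Literature.Analysis.Calculus.ParametricContraction`)
applied to the uniform contraction `T` (Theorem 7.2.2), continuous in `p` for each `x ∈ B₁`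
(Lemma 7.2.1). [cite: Slade2017, Corollary 7.2.4] -/
theorem Slade2017_cor724 {P : Type*} [TopologicalSpace P] [∀ j, CompleteSpace (W j)]
    {S : Set P} {d : P → Data W}
    (h : ∀ p ∈ S, Hyp c (d p) y₀ K₀)
    (hβ : ∀ j, ContinuousOn (fun p => (d p).β j) S)
    (hβW : ∀ j, ContinuousOn (fun p => (d p).βW j) S)
    (hξ : ∀ j, ContinuousOn (fun p => (d p).ξ j) S)
    (hrμ : ∀ j m y (K : W j), ContinuousOn (fun p => (d p).rμ j m y K) S)
    (hry : ∀ j m y (K : W j), ContinuousOn (fun p => (d p).ry j m y K) S)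
    (hKc : ∀ j m y (K : W j), ContinuousOn (fun p => (d p).Kc j m y K) S)
    (hw : ∀ j, ContinuousOn (fun p => (d p).w j) S)
    (hsupp : ∀ p₀ ∈ S, ∃ U ∈ 𝓝[S] p₀, ∃ J : ℕ, ∀ p ∈ U, ∀ j, J ≤ j → (d p).w j = 0) :
    ∃ xs : P → X W, ContinuousOn xs S ∧ ContinuousOn (fun p => μv c (xs p) 0) S ∧
      (∀ p ∈ S, (∀ j, ‖xs p j‖ ≤ 1) ∧ ⇑(xs p) = Trow c (d p) y₀ K₀ (xs p)) ∧
      ∀ p ∈ S, ∀ y : X W, (∀ j, ‖y j‖ ≤ 1) → ⇑y = Trow c (d p) y₀ K₀ y → y = xs p := by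
  rcases S.eq_empty_or_nonempty with hS | ⟨p₁, hp₁⟩
  · subst hS
    exact ⟨fun _ => 0, continuousOn_empty _, continuousOn_empty _, fun p hp => hp.elim,
      fun p hp => hp.elim⟩
  have h₁ := h p₁ hp₁
  have hc' : Real.toNNReal c.cLip < 1 := Real.toNNReal_lt_one.2 h₁.cLip_lt_one
  have hcoe : ((Real.toNNReal c.cLip : ℝ≥0) : ℝ) = c.cLip := Real.coe_toNNReal _ h₁.cLip_nonneg
  obtain ⟨xs, hcont, hfix, huniq⟩ := FlowSpace.exists_fixedPoint (P := P) (S := S)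
    (Φ := fun p => Trow c (d p) y₀ K₀) hc'
    (fun p hp x hx j => (h p hp).norm_trow_le hx j)
    (fun p hp x x' hx hx' j => by
      rw [hcoe]
      exact (h p hp).dist_trow_le hx hx' (fun j => FlowSpace.dist_apply_le x x' j) j)
    (fun x hx j => by
      have := Slade2017_lem721 (c := c) (y₀ := y₀) (K₀ := K₀) h hβ hβW hξ hrμ hry hKc hw hsupp x hx
      -- extract the coordinate from the continuity of the lifted operator
      have hb : ∀ p ∈ S, ⇑(FlowSpace.liftOp (Trow c (d p) y₀ K₀) x) = Trow c (d p) y₀ K₀ x :=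
        fun p hp => FlowSpace.coeFn_liftOp (C := 1) fun j => (h p hp).norm_trow_le hx j
      have h2 : ContinuousOn (fun p => (FlowSpace.liftOp (Trow c (d p) y₀ K₀) x) j) S :=
        (FlowSpace.continuous_apply j).comp_continuousOn this
      exact h2.congr fun p hp => by simp only [hb p hp])
    (fun x hx p₀ hp₀ => by
      obtain ⟨U, hU, J, hJ⟩ := hsupp p₀ hp₀
      exact ⟨U, hU, J, fun p hp j hj => Trow_eq_zero_of_w (hJ p hp j hj)⟩)
  refine ⟨xs, hcont, ?_, hfix, huniq⟩
  have h0 : ContinuousOn (fun p => (xs p) 0) S :=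
    (FlowSpace.continuous_apply 0).comp_continuousOn hcont
  exact continuousOn_const.mul (continuous_fst.comp_continuousOn h0)

/-! ### The truncation weights of (7.25)–(7.27) -/

/-- The truncation weights smoothing `T̂` into `T`: with `f = f_m̃` (`j_m̃ = ⌈f⌉`,
`δ_m̃ = ⌈f⌉ - f`), `w_j = 1` for `j ≤ ⌈f⌉`, `w_{⌈f⌉+1} = 1 - δ_m̃`, `w_j = 0` for `j ≥ ⌈f⌉ + 2`;
in closed form `w_j = min(1, max(0, f + 2 - j))`. [cite: Slade2017, §7.2.2 ((7.25)–(7.27))] -/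
def truncWeight (f : ℝ) (j : ℕ) : ℝ := min 1 (max 0 (f + 2 - j))

/-- `w_j ≥ 0`. [cite: Slade2017, §7.2.2 ((7.25)–(7.27))] -/
theorem truncWeight_nonneg (f : ℝ) (j : ℕ) : 0 ≤ truncWeight f j :=
  le_min zero_le_one (le_max_left _ _)

/-- `w_j ≤ 1`. [cite: Slade2017, §7.2.2 ((7.25)–(7.27))] -/
theorem truncWeight_le_one (f : ℝ) (j : ℕ) : truncWeight f j ≤ 1 := min_le_left _ _

/-- `w_j = 1` for `j ≤ ⌈f⌉ = j_m̃` (`T_j = T̂_j`). [cite: Slade2017, §7.2.2 ((7.22)–(7.24))] -/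
theorem truncWeight_eq_one {f : ℝ} (hf : 0 ≤ f) {j : ℕ} (hj : j ≤ ⌈f⌉₊) : truncWeight f j = 1 := by
  have h1 : (⌈f⌉₊ : ℝ) < f + 1 := Nat.ceil_lt_add_one hf
  have hj' : (j : ℝ) ≤ ⌈f⌉₊ := by exact_mod_cast hj
  rw [truncWeight, min_eq_left]
  exact le_max_of_le_right (by linarith)

/-- `w_{j_m̃+1} = 1 - δ_m̃`, `δ_m̃ = ⌈f_m̃⌉ - f_m̃`. [cite: Slade2017, §7.2.2 ((7.25)–(7.27))] -/
theorem truncWeight_ceil_succ {f : ℝ} (hf : 0 ≤ f) : truncWeight f (⌈f⌉₊ + 1) = f + 1 - ⌈f⌉₊ := by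
  have h1 : (⌈f⌉₊ : ℝ) < f + 1 := Nat.ceil_lt_add_one hf
  have h2 : f ≤ ⌈f⌉₊ := Nat.le_ceil f
  rw [truncWeight, min_eq_right, max_eq_right] <;> push_cast
  · ring
  · linarith
  · refine max_le zero_le_one ?_; linarith

/-- `w_j = 0` for `j ≥ j_m̃ + 2` (`(Tx)_j = 0`). [cite: Slade2017, §7.2.2] -/
theorem truncWeight_eq_zero {f : ℝ} {j : ℕ} (hj : ⌈f⌉₊ + 2 ≤ j) : truncWeight f j = 0 := by
  have h2 : f ≤ ⌈f⌉₊ := Nat.le_ceil f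
  have hj' : (⌈f⌉₊ : ℝ) + 2 ≤ j := by exact_mod_cast hj
  rw [truncWeight, max_eq_left (by linarith), min_eq_right zero_le_one]

/-- The weights are continuous in `f` ("This shows the required continuity of `(Tx)_j` as `m̃`
varies through `j_{m̃_*}`"). [cite: Slade2017, Lemma 7.2.1 (proof)] -/
theorem continuous_truncWeight (j : ℕ) : Continuous fun f => truncWeight f j :=
  continuous_const.min (continuous_const.max ((continuous_id.add continuous_const).sub
    continuous_const))

/-- Continuity and local finiteness of the weights along a continuous `f : P → ℝ` (in the
source `f = f_m̃ = 1 + α⁻¹ log_L m̃⁻²` on `𝕄`): the hypotheses `hw`, `hsupp` of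
`Slade2017_lem721` / `Slade2017_cor724`. [cite: Slade2017, Lemma 7.2.1 (proof)] -/
theorem truncWeight_hyp {P : Type*} [TopologicalSpace P] {S : Set P} {f : P → ℝ}
    (hf : ContinuousOn f S) :
    (∀ j, ContinuousOn (fun p => truncWeight (f p) j) S) ∧
    (∀ p₀ ∈ S, ∃ U ∈ 𝓝[S] p₀, ∃ J : ℕ, ∀ p ∈ U, ∀ j, J ≤ j → truncWeight (f p) j = 0) := by
  refine ⟨fun j => (continuous_truncWeight j).comp_continuousOn hf, fun p₀ hp₀ => ?_⟩
  refine ⟨S ∩ f ⁻¹' Iio (f p₀ + 1), ?_, ⌈f p₀ + 1⌉₊ + 2, fun p hp j hj => ?_⟩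
  · exact inter_mem self_mem_nhdsWithin
      ((hf.continuousWithinAt hp₀).preimage_mem_nhdsWithin (Iio_mem_nhds (by linarith)))
  · apply truncWeight_eq_zero
    have hp' : f p < f p₀ + 1 := hp.2
    have : ⌈f p⌉₊ ≤ ⌈f p₀ + 1⌉₊ := Nat.ceil_le_ceil hp'.le
    omega

end FixedPoint

end CriticalFlow

end LongRangePhi4

end Literature.Barriers.CriticalPhenomena
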